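import Literature.NumberTheory.LFunctions.HalaszRestrictedEuler
import Literature.NumberTheory.LFunctions.HalaszMeanSquare
import HarnessLib

/-!
# Halász's theorem for block-restricted sums, II: the logarithmic derivative and its mean square

Second file of the restricted Halász theorem (see `HalaszRestrictedEuler.lean` for the setting:
`g` completely multiplicative with `|g| ≤ 1`, blocks `blk i`, `i ∈ 𝓙`, of primes `≤ N`, the restricted
function `a = g̃ 1_𝒮`).  Following Granville–Soundararajan 2003, §3b (tree file
`HalaszMeanSquare.lean`, which treats `D = P · G` for completely multiplicative `g`), we bound the
weighted mean square `J(α) = ∫ |A(e^u)|² e^{-2(1+α)u} du` of `A(y) = ∑_{n ≤ y} a(n) log n` — by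
Mellin–Plancherel `(1/2π) ∫ |D_a(1+α+iy)|²/|1+α+iy|² dy` with `D_a(s) = ∑ a(n) log n · n^{-s}` — where now

* `mulLog_restr_eq` — **the substitute for `D = P G`**: since `1_𝒮(p^k m) = 1_𝒮(m)` for `p ∉ E` and
  `1_𝒮(p^k m) = 1_{𝒮_i}(m)` for `p ∈ blk i` (`𝒮_i`: a prime factor in every OTHER block),
  `a · log = (g̃Λ 1_{∁E}) ⋆ a + ∑_i (g̃Λ 1_{blk i}) ⋆ a_i`, `a_i = g̃ 1_{𝒮_i}`; as Dirichlet series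
  `D_a = P_∁ · 𝒢_a + ∑_i P_i · 𝒢_{a_i}` (`LSeries_mulLog_restr_eq`);
* `setIntegral_window_restr_le` — the window `|y| ≤ T₀`: with `|𝒢_a| ≤ B` there and the crude
  `|𝒢_{a_i}| ≤ B_c`, `∫_{|y|≤T₀} |D_a/s|² ≤ 2B² ∫|P_∁/s|² + 2 B_c² |𝓙| ∑_i ∫ |P_i/s|²`, where
  `∫|P_∁/s|² ≤ 2π · 18/α` (Chebyshev, tree) and, the block `blk i` consisting of primes `≤ Q` (`Q ≥ e²`),
  `∫ |P_i/s|² ≤ 2π (36 log Q + 25)` (`meanSquare_vmIn_le`: `|∑_{n ≤ y} (g̃Λ1_{blk i})(n)| ≤ min(ψ(y), |blk i| log y)`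
  and `|blk i| ≤ π(Q) ≤ 5Q/log Q`) — no `1/α` here, which is what makes the blocks harmless;
* `setIntegral_Ioi_dyadic_tail_le`, `setIntegral_Iio_dyadic_tail_le` — the tails `|y| > T₀` by DYADIC
  blocks and the mean value theorem sharp in the length (`DirichletMVTSharp`):
  `≤ 240/T₀ + (1920 + 520 e^{10}/α³)/T₀²` each (via `∑ |c_n|² ≤ 48`, `tsum_norm_term_mulLog_sq_le`,
  uniformly in `α`), i.e. decay `1/T₀` with an `α`-free constant plus `1/(α³ T₀²)` (the tree's unit
  blocks give `1/(α³ T₀)`); this yields the Granville–Soundararajan quality `1/T` (rather than `1/√T`)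
  in the final theorem, needed when the theorem is integrated over `t` near the pretentious twist;
* `meanSquare_mulLog_restr_le` — the resulting bound
  `J(α) ≤ 36B²/α + 2B_c²|𝓙|²(36 log Q + 25) + (1/π)(240/T₀ + (1920 + 520e^{10}/α³)/T₀²)`.

Everything here is generic in `a` except the two structural inputs from part I.

## References
* A. Granville, K. Soundararajan, *Decay of mean values of multiplicative functions*, Canad. J.
  Math. 55 (2003), §3b, Lemma 3.2. [cite: GranvilleSoundararajan2003, Lemma 3.2]
* H. L. Montgomery, R. C. Vaughan, *Hilbert's inequality* (1974), Cor. 3 (tree: `DirichletMVTSharp`).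
-/

noncomputable section

open Finset Real Complex MeasureTheory
open scoped ComplexConjugate

namespace Literature.NumberTheory.LFunctions

namespace Halasz

namespace Restricted

open MellinPlancherel (psum)
open ArithmeticFunction (vonMangoldt)

variable {ι : Type*} {𝓙 : Finset ι} {blk : ι → Finset ℕ} {g : ℕ → ℂ} {N : ℕ}

/-! ### Prime powers and the blocks -/

/-- If `Λ(d) ≠ 0` then `d = p^k` with `p` prime, `k ≥ 1`. [folklore] -/
theorem exists_eq_pow_of_vonMangoldt_ne_zero {d : ℕ} (h : (vonMangoldt d : ℝ) ≠ 0) :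
    ∃ p k : ℕ, p.Prime ∧ 0 < k ∧ d = p ^ k := by
  obtain ⟨p, k, hp, hk, hd⟩ := (isPrimePow_nat_iff d).mp (ArithmeticFunction.vonMangoldt_ne_zero_iff.mp h)
  exact ⟨p, k, hp, hk, hd.symm⟩

/-- A prime divides a prime power `p^k` (`k ≥ 1`) iff it is `p`. [folklore] -/
theorem prime_dvd_primePow_iff {p k q : ℕ} (hp : p.Prime) (hq : q.Prime) (hk : 0 < k) :
    q ∣ p ^ k ↔ q = p := by
  constructor
  · intro h
    exact (Nat.prime_dvd_prime_iff_eq hq hp).mp (hq.dvd_of_dvd_pow h)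
  · rintro rfl
    exact dvd_pow_self q hk.ne'

/-- `1_{(p^k, P)=1} = [p ∉ P]` for a set of primes `P`. [folklore] -/
theorem copInd_primePow {P : Finset ℕ} (hP : ∀ q ∈ P, q.Prime) {p k : ℕ} (hp : p.Prime) (hk : 0 < k) :
    copInd P (p ^ k) = if p ∈ P then 0 else 1 := by
  unfold copInd
  by_cases h : p ∈ P
  · rw [if_pos h, if_neg]
    intro h'
    exact h' p h (dvd_pow_self p hk.ne')
  · rw [if_neg h, if_pos]
    intro q hq hqp
    have : q = p := (prime_dvd_primePow_iff hp (hP q hq) hk).mp hqp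
    exact h (this ▸ hq)

/-- Multiplying by a prime power OUTSIDE all blocks does not change membership in `𝒮`. [folklore] -/
theorem memBlocks_primePow_mul_iff (hblk : ∀ i ∈ 𝓙, ∀ q ∈ blk i, q.Prime) {p k : ℕ} (hp : p.Prime)
    (hpE : ∀ i ∈ 𝓙, p ∉ blk i) (m : ℕ) :
    MemBlocks 𝓙 blk (p ^ k * m) ↔ MemBlocks 𝓙 blk m := by
  constructor
  · intro h i hi
    obtain ⟨q, hq, hqd⟩ := h i hi
    refine ⟨q, hq, ?_⟩
    rcases (hblk i hi q hq).dvd_mul.mp hqd with h1 | h1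
    · have : q = p := (Nat.prime_dvd_prime_iff_eq (hblk i hi q hq) hp).mp ((hblk i hi q hq).dvd_of_dvd_pow h1)
      exact absurd (this ▸ hq) (hpE i hi)
    · exact h1
  · intro h i hi
    obtain ⟨q, hq, hqm⟩ := h i hi
    exact ⟨q, hq, Dvd.dvd.mul_left hqm _⟩

/-- Multiplying by a power of a prime of the block `blk i₀` (`k ≥ 1`): `p^k m ∈ 𝒮` iff `m` has a
prime factor in every other block. [folklore] -/
theorem memBlocks_primePow_mul_iff_erase [DecidableEq ι] (h : IsBlockSystem 𝓙 blk N) {i₀ : ι}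
    (hi₀ : i₀ ∈ 𝓙) {p k : ℕ} (hp : p ∈ blk i₀) (hk : 0 < k) (m : ℕ) :
    MemBlocks 𝓙 blk (p ^ k * m) ↔ MemBlocks (𝓙.erase i₀) blk m := by
  have hpp : p.Prime := h.prime_of_mem hi₀ hp
  constructor
  · intro hm i hi
    obtain ⟨hii₀, hi𝓙⟩ := Finset.mem_erase.mp hi
    obtain ⟨q, hq, hqd⟩ := hm i hi𝓙
    have hqp : q.Prime := h.prime_of_mem hi𝓙 hq
    refine ⟨q, hq, ?_⟩
    rcases hqp.dvd_mul.mp hqd with h1 | h1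
    · have hqp' : q = p := (prime_dvd_primePow_iff hpp hqp hk).mp h1
      have : q ∈ blk i₀ := hqp' ▸ hp
      exact absurd this (Finset.disjoint_left.mp (h.disjoint i hi𝓙 i₀ hi₀ hii₀) hq)
    · exact h1
  · intro hm i hi
    by_cases hii₀ : i = i₀
    · subst hii₀
      exact ⟨p, hp, Dvd.dvd.mul_right (dvd_pow_self p hk.ne') m⟩
    · obtain ⟨q, hq, hqm⟩ := hm i (Finset.mem_erase.mpr ⟨hii₀, hi⟩)
      exact ⟨q, hq, Dvd.dvd.mul_left hqm _⟩

/-- Indicator form of `memBlocks_primePow_mul_iff`. [folklore] -/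
theorem blockInd_primePow_mul (hblk : ∀ i ∈ 𝓙, ∀ q ∈ blk i, q.Prime) {p k : ℕ} (hp : p.Prime)
    (hpE : ∀ i ∈ 𝓙, p ∉ blk i) (m : ℕ) :
    blockInd 𝓙 blk (p ^ k * m) = blockInd 𝓙 blk m := by
  unfold blockInd
  rw [memBlocks_primePow_mul_iff hblk hp hpE m]

/-- Indicator form of `memBlocks_primePow_mul_iff_erase`. [folklore] -/
theorem blockInd_primePow_mul_erase [DecidableEq ι] (h : IsBlockSystem 𝓙 blk N) {i₀ : ι}
    (hi₀ : i₀ ∈ 𝓙) {p k : ℕ} (hp : p ∈ blk i₀) (hk : 0 < k) (m : ℕ) :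
    blockInd 𝓙 blk (p ^ k * m) = blockInd (𝓙.erase i₀) blk m := by
  unfold blockInd
  rw [memBlocks_primePow_mul_iff_erase h hi₀ hp hk m]

/-! ### The von Mangoldt pieces `g̃Λ 1_{∁E}` and `g̃Λ 1_{blk i}` -/

/-- The block piece of `g̃ Λ`: `(g̃Λ)(n) · [some prime of P divides n]`; on prime powers `p^k` this is
`g̃(p^k) log p · [p ∈ P]`. [folklore] -/
def vmIn (P : Finset ℕ) (g : ℕ → ℂ) (N : ℕ) : ℕ → ℂ := fun n => mulVM g N n * (1 - copInd P n)

/-- `‖(1 - 1_{(n,P)=1})‖ ≤ 1`. [folklore] -/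
theorem norm_one_sub_copInd_le (P : Finset ℕ) (n : ℕ) : ‖1 - copInd P n‖ ≤ 1 := by
  unfold copInd; split_ifs <;> simp

/-- `‖vmIn(n)‖ ≤ ‖(g̃Λ)(n)‖ ≤ Λ(n)`. [folklore] -/
theorem norm_vmIn_le (hgb : ∀ n, ‖g n‖ ≤ 1) (P : Finset ℕ) (n : ℕ) :
    ‖vmIn P g N n‖ ≤ vonMangoldt n := by
  unfold vmIn
  rw [norm_mul]
  calc ‖mulVM g N n‖ * ‖1 - copInd P n‖ ≤ vonMangoldt n * 1 := by
        gcongr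
        · exact norm_mulVM_le hgb n
        · exact norm_one_sub_copInd_le P n
    _ = vonMangoldt n := mul_one _

/-- `vmIn` vanishes unless `n` is a prime power of a prime of `P` (here: unless some `p ∈ P` divides `n`).
[folklore] -/
theorem vmIn_eq_zero_of_forall (P : Finset ℕ) {n : ℕ} (h : ∀ p ∈ P, ¬ p ∣ n) : vmIn P g N n = 0 := by
  unfold vmIn copInd
  rw [if_pos h, sub_self, mul_zero]

/-- The outside piece: `mulVM (sieveOut E g) N = g̃Λ · 1_{(n,E)=1}`. [folklore] -/
theorem mulVM_sieveOut_apply (E : Finset ℕ) (n : ℕ) :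
    mulVM (sieveOut E g) N n = mulVM g N n * copInd E n := by
  unfold mulVM
  have hsc : smoothCut (sieveOut E g) N n = smoothCut g N n * copInd E n := by
    by_cases hn : n ∈ Nat.smoothNumbers (N + 1)
    · rw [smoothCut_of_mem hn, smoothCut_of_mem hn]; rfl
    · rw [smoothCut_of_not_mem hn, smoothCut_of_not_mem hn, zero_mul]
  rw [hsc]
  ring

/-- The smooth truncation does not change the (already smooth-supported) restricted function. [folklore] -/
theorem smoothCut_restr (n : ℕ) : smoothCut (restr 𝓙 blk g N) N n = restr 𝓙 blk g N n := by
  by_cases hn : n ∈ Nat.smoothNumbers (N + 1)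
  · rw [smoothCut_of_mem hn]
  · rw [smoothCut_of_not_mem hn]
    unfold restr
    rw [smoothCut_of_not_mem hn, zero_mul]

/-- `(a log)(n) = a(n) log n`. [folklore] -/
theorem mulLog_restr_apply (n : ℕ) : mulLog (restr 𝓙 blk g N) N n = restr 𝓙 blk g N n * (Real.log n : ℂ) := by
  unfold mulLog
  rw [smoothCut_restr]

/-! ### The substitute for `D = P · G`: the convolution identity -/

/-- **Termwise identity**: for `d m = n`,
`Λ(d) a(dm) = (g̃Λ1_{∁E})(d) a(m) + ∑_{i ∈ 𝓙} (g̃Λ1_{blk i})(d) a_i(m)`. [folklore] -/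
theorem vonMangoldt_mul_restr_mul [DecidableEq ι] (h : IsBlockSystem 𝓙 blk N)
    (hg : ∀ m n, g (m * n) = g m * g n) (d m : ℕ) :
    (vonMangoldt d : ℂ) * restr 𝓙 blk g N (d * m) =
      mulVM (sieveOut (𝓙.biUnion blk) g) N d * restr 𝓙 blk g N m +
        ∑ i ∈ 𝓙, vmIn (blk i) g N d * restr (𝓙.erase i) blk g N m := by
  set E := 𝓙.biUnion blk with hE
  have hEprime : ∀ q ∈ E, q.Prime := fun q hq => h.prime_of_mem_biUnion (t := 𝓙) le_rfl hq
  have hblkprime : ∀ i ∈ 𝓙, ∀ q ∈ blk i, q.Prime := fun i hi q hq => h.prime_of_mem hi hq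
  by_cases hΛ : (vonMangoldt d : ℝ) = 0
  · -- both sides vanish
    have h1 : mulVM (sieveOut E g) N d = 0 := by simp [mulVM, hΛ]
    have h2 : ∀ i ∈ 𝓙, vmIn (blk i) g N d = 0 := fun i _ => by simp [vmIn, mulVM, hΛ]
    rw [h1, zero_mul, zero_add, Finset.sum_eq_zero (fun i hi => by rw [h2 i hi, zero_mul])]
    simp [hΛ]
  · obtain ⟨p, k, hp, hk, rfl⟩ := exists_eq_pow_of_vonMangoldt_ne_zero hΛ
    -- split the smooth truncation
    have hsplit : restr 𝓙 blk g N (p ^ k * m) =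
        smoothCut g N (p ^ k) * smoothCut g N m * blockInd 𝓙 blk (p ^ k * m) := by
      unfold restr; rw [smoothCut_mul hg]
    by_cases hpE : p ∈ E
    · -- `p` lies in a (unique) block `i₀`
      obtain ⟨i₀, hi₀, hpi₀⟩ := Finset.mem_biUnion.mp hpE
      have hout : mulVM (sieveOut E g) N (p ^ k) = 0 := by
        rw [mulVM_sieveOut_apply, copInd_primePow hEprime hp hk, if_pos hpE, mul_zero]
      have hin : ∀ i ∈ 𝓙, i ≠ i₀ → vmIn (blk i) g N (p ^ k) = 0 := by
        intro i hi hii₀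
        refine vmIn_eq_zero_of_forall _ fun q hq hqd => ?_
        have hqp : q = p := (prime_dvd_primePow_iff hp (hblkprime i hi q hq) hk).mp hqd
        exact Finset.disjoint_left.mp (h.disjoint i hi i₀ hi₀ hii₀) hq (hqp ▸ hpi₀)
      have hin₀ : vmIn (blk i₀) g N (p ^ k) = mulVM g N (p ^ k) := by
        unfold vmIn
        rw [copInd_primePow (hblkprime i₀ hi₀) hp hk, if_pos hpi₀, sub_zero, mul_one]
      rw [hout, zero_mul, zero_add, Finset.sum_eq_single_of_mem i₀ hi₀ (fun i hi hii₀ => by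
        rw [hin i hi hii₀, zero_mul]), hin₀, hsplit, blockInd_primePow_mul_erase h hi₀ hpi₀ hk m]
      unfold mulVM restr
      ring
    · -- `p` outside all blocks
      have hpE' : ∀ i ∈ 𝓙, p ∉ blk i := fun i hi hpi => hpE (Finset.mem_biUnion.mpr ⟨i, hi, hpi⟩)
      have hout : mulVM (sieveOut E g) N (p ^ k) = mulVM g N (p ^ k) := by
        rw [mulVM_sieveOut_apply, copInd_primePow hEprime hp hk, if_neg hpE, mul_one]
      have hin : ∀ i ∈ 𝓙, vmIn (blk i) g N (p ^ k) = 0 := by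
        intro i hi
        refine vmIn_eq_zero_of_forall _ fun q hq hqd => ?_
        have hqp : q = p := (prime_dvd_primePow_iff hp (hblkprime i hi q hq) hk).mp hqd
        exact hpE' i hi (hqp ▸ hq)
      rw [hout, Finset.sum_eq_zero (fun i hi => by rw [hin i hi, zero_mul]), add_zero, hsplit,
        blockInd_primePow_mul hblkprime hp hpE' m]
      unfold mulVM restr
      ring

/-- **The convolution identity** (substitute for `(g̃Λ) ⋆ g̃ = g̃ log`):
`a · log = (g̃Λ1_{∁E}) ⋆ a + ∑_{i ∈ 𝓙} (g̃Λ1_{blk i}) ⋆ a_i`. [folklore] -/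
theorem mulLog_restr_eq [DecidableEq ι] (h : IsBlockSystem 𝓙 blk N)
    (hg : ∀ m n, g (m * n) = g m * g n) :
    mulLog (restr 𝓙 blk g N) N =
      LSeries.convolution (mulVM (sieveOut (𝓙.biUnion blk) g) N) (restr 𝓙 blk g N) +
        ∑ i ∈ 𝓙, LSeries.convolution (vmIn (blk i) g N) (restr (𝓙.erase i) blk g N) := by
  funext n
  rw [Pi.add_apply, Finset.sum_apply, mulLog_restr_apply]
  simp only [LSeries.convolution_def]
  rw [Finset.sum_comm, ← Finset.sum_add_distrib]
  -- now the right side is a sum over the antidiagonal; rewrite it as a sum over divisors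
  rw [Nat.sum_divisorsAntidiagonal (f := fun d e => mulVM (sieveOut (𝓙.biUnion blk) g) N d * restr 𝓙 blk g N e +
      ∑ i ∈ 𝓙, vmIn (blk i) g N d * restr (𝓙.erase i) blk g N e)]
  have hlog : (Real.log n : ℂ) = ∑ d ∈ n.divisors, (vonMangoldt d : ℂ) := by
    rw [← Complex.ofReal_sum, ArithmeticFunction.vonMangoldt_sum]
  rw [hlog, Finset.mul_sum]
  refine Finset.sum_congr rfl fun d hd => ?_
  have hdn : d * (n / d) = n := Nat.mul_div_cancel' (Nat.dvd_of_mem_divisors hd)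
  rw [← vonMangoldt_mul_restr_mul h hg d (n / d), hdn]
  ring

/-! ### Summability of the pieces and the identity of Dirichlet series -/

/-- `‖vmIn(n)‖ ≤ ‖(g̃Λ)(n)‖`. [folklore] -/
theorem norm_vmIn_le_norm_mulVM (P : Finset ℕ) (n : ℕ) : ‖vmIn P g N n‖ ≤ ‖mulVM g N n‖ := by
  unfold vmIn
  rw [norm_mul]
  exact mul_le_of_le_one_right (norm_nonneg _) (norm_one_sub_copInd_le P n)

/-- The block piece has an absolutely convergent Dirichlet series on `Re s > 1`. [folklore] -/
theorem LSeriesSummable_vmIn (hgb : ∀ n, ‖g n‖ ≤ 1) (P : Finset ℕ) {s : ℂ} (hs : 1 < s.re) :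
    LSeriesSummable (vmIn P g N) s := by
  have h := (LSeriesSummable_mulVM (g := g) (N := N) hgb hs).norm
  refine Summable.of_norm_bounded h (fun n => ?_)
  rcases Nat.eq_zero_or_pos n with rfl | hn
  · simp
  · rw [LSeries.term_of_ne_zero hn.ne', LSeries.term_of_ne_zero hn.ne', norm_div, norm_div]
    gcongr
    exact norm_vmIn_le_norm_mulVM P n

/-- `∑ ‖vmIn(n)‖ n^{-σ} < ∞` for `σ > 1`. [folklore] -/
theorem summable_norm_vmIn_div_rpow (hgb : ∀ n, ‖g n‖ ≤ 1) (P : Finset ℕ) {σ : ℝ} (hσ : 1 < σ) :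
    Summable fun n : ℕ => ‖vmIn P g N n‖ / (n : ℝ) ^ σ := by
  have h := (LSeriesSummable_vmIn (N := N) hgb P (s := (σ : ℂ)) (by simpa using hσ)).norm
  refine h.congr fun n => ?_
  rcases Nat.eq_zero_or_pos n with rfl | hn
  · simp [vmIn, mulVM_zero]
  · rw [LSeries.norm_term_eq, if_neg hn.ne', Complex.ofReal_re]

/-- The restricted function of a block system has an absolutely convergent series on `Re s > 0`. [folklore] -/
theorem LSeriesSummable_restr [DecidableEq ι] (h : IsBlockSystem 𝓙 blk N)
    (hg : ∀ m n, g (m * n) = g m * g n) (hg1 : g 1 = 1) (hgb : ∀ n, ‖g n‖ ≤ 1) {s : ℂ}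
    (hs : 0 < s.re) : LSeriesSummable (restr 𝓙 blk g N) s :=
  (LSeries_restr_eq h hg hg1 hgb hs).1

/-- **`D_a = P_∁ 𝒢_a + ∑_i P_i 𝒢_{a_i}`** on `Re s > 1`. [folklore] -/
theorem LSeries_mulLog_restr_eq [DecidableEq ι] (h : IsBlockSystem 𝓙 blk N)
    (hg : ∀ m n, g (m * n) = g m * g n) (hg1 : g 1 = 1) (hgb : ∀ n, ‖g n‖ ≤ 1) {s : ℂ}
    (hs : 1 < s.re) :
    LSeries (mulLog (restr 𝓙 blk g N) N) s =
      LSeries (mulVM (sieveOut (𝓙.biUnion blk) g) N) s * LSeries (restr 𝓙 blk g N) s +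
        ∑ i ∈ 𝓙, LSeries (vmIn (blk i) g N) s * LSeries (restr (𝓙.erase i) blk g N) s := by
  have hs0 : 0 < s.re := by linarith
  have hA : LSeriesSummable (restr 𝓙 blk g N) s := LSeriesSummable_restr h hg hg1 hgb hs0
  have hAi : ∀ i ∈ 𝓙, LSeriesSummable (restr (𝓙.erase i) blk g N) s := fun i _ =>
    LSeriesSummable_restr (h.mono (Finset.erase_subset i 𝓙)) hg hg1 hgb hs0
  have hP : LSeriesSummable (mulVM (sieveOut (𝓙.biUnion blk) g) N) s :=
    LSeriesSummable_mulVM (norm_sieveOut_le hgb _) hs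
  have hPi : ∀ i ∈ 𝓙, LSeriesSummable (vmIn (blk i) g N) s := fun i _ => LSeriesSummable_vmIn hgb _ hs
  rw [mulLog_restr_eq h hg, LSeries_add (hP.convolution hA)
    (LSeriesSummable.sum fun i hi => (hPi i hi).convolution (hAi i hi)),
    LSeries_convolution' hP hA, LSeries_sum fun i hi => (hPi i hi).convolution (hAi i hi)]
  congr 1
  exact Finset.sum_congr rfl fun i hi => LSeries_convolution' (hPi i hi) (hAi i hi)

/-! ### The window `|y| ≤ T₀` -/

/-- `(∑_{i ∈ 𝓙} u_i)² ≤ |𝓙| ∑ u_i²` (Cauchy–Schwarz). [folklore] -/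
theorem sq_sum_le (𝓙 : Finset ι) (u : ι → ℝ) : (∑ i ∈ 𝓙, u i) ^ 2 ≤ 𝓙.card * ∑ i ∈ 𝓙, u i ^ 2 :=
  sq_sum_le_card_mul_sum_sq

/-- The real inequality behind the window bound: if `0 ≤ z ≤ B P₀ + B_c S` and `S² ≤ m T` then
`z² ≤ 2B² P₀² + 2 B_c² m T`. [folklore] -/
theorem sq_le_of_le_lin {z B P₀ Bc S m T : ℝ} (hz : 0 ≤ z) (hle : z ≤ B * P₀ + Bc * S)
    (hST : S ^ 2 ≤ m * T) :
    z ^ 2 ≤ 2 * B ^ 2 * P₀ ^ 2 + 2 * Bc ^ 2 * m * T := by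
  have h1 : z ^ 2 ≤ (B * P₀ + Bc * S) ^ 2 := pow_le_pow_left₀ hz hle 2
  have h2 : (B * P₀ + Bc * S) ^ 2 ≤ 2 * (B * P₀) ^ 2 + 2 * (Bc * S) ^ 2 := by
    nlinarith [sq_nonneg (B * P₀ - Bc * S)]
  have h3 : (Bc * S) ^ 2 ≤ Bc ^ 2 * (m * T) := by
    rw [mul_pow]; exact mul_le_mul_of_nonneg_left hST (sq_nonneg _)
  nlinarith

/-- **Pointwise in the window**: if `‖𝒢_a(s)‖ ≤ B` and `‖𝒢_{a_i}(s)‖ ≤ B_c` then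
`‖D_a(s)‖² ≤ 2B² ‖P_∁(s)‖² + 2 B_c² |𝓙| ∑_i ‖P_i(s)‖²`. [folklore] -/
theorem norm_mulLog_restr_sq_le [DecidableEq ι] (h : IsBlockSystem 𝓙 blk N)
    (hg : ∀ m n, g (m * n) = g m * g n) (hg1 : g 1 = 1) (hgb : ∀ n, ‖g n‖ ≤ 1) {s : ℂ}
    (hs : 1 < s.re) {B Bc : ℝ} (hB : ‖LSeries (restr 𝓙 blk g N) s‖ ≤ B)
    (hBc : ∀ i ∈ 𝓙, ‖LSeries (restr (𝓙.erase i) blk g N) s‖ ≤ Bc) :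
    ‖LSeries (mulLog (restr 𝓙 blk g N) N) s‖ ^ 2 ≤
      2 * B ^ 2 * ‖LSeries (mulVM (sieveOut (𝓙.biUnion blk) g) N) s‖ ^ 2 +
        2 * Bc ^ 2 * 𝓙.card * ∑ i ∈ 𝓙, ‖LSeries (vmIn (blk i) g N) s‖ ^ 2 := by
  rw [LSeries_mulLog_restr_eq h hg hg1 hgb hs]
  have h1 : ‖LSeries (mulVM (sieveOut (𝓙.biUnion blk) g) N) s * LSeries (restr 𝓙 blk g N) s +
      ∑ i ∈ 𝓙, LSeries (vmIn (blk i) g N) s * LSeries (restr (𝓙.erase i) blk g N) s‖ ≤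
      B * ‖LSeries (mulVM (sieveOut (𝓙.biUnion blk) g) N) s‖ +
        Bc * ∑ i ∈ 𝓙, ‖LSeries (vmIn (blk i) g N) s‖ := by
    refine (norm_add_le _ _).trans (add_le_add ?_ ?_)
    · rw [norm_mul, mul_comm]
      exact mul_le_mul_of_nonneg_right hB (norm_nonneg _)
    · refine (norm_sum_le _ _).trans ?_
      rw [Finset.mul_sum]
      refine Finset.sum_le_sum fun i hi => ?_
      rw [norm_mul, mul_comm]
      exact mul_le_mul_of_nonneg_right (hBc i hi) (norm_nonneg _)
  exact sq_le_of_le_lin (norm_nonneg _) h1 (sq_sum_le 𝓙 _)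

/-- The weighted `P`-integrals are finite: `y ↦ |P(1+α+iy)|²/|1+α+iy|²` is integrable for the outside
piece. [folklore] -/
theorem integrable_normSq_mulVM_sieveOut_div (hgb : ∀ n, ‖g n‖ ≤ 1) (E : Finset ℕ) {α : ℝ} (hα : 0 < α) :
    Integrable fun y : ℝ => ‖LSeries (mulVM (sieveOut E g) N) (1 + α + y * I)‖ ^ 2 /
      ‖(1 : ℂ) + α + y * I‖ ^ 2 := by
  have h := integrable_norm_LSeries_sq_div (a := mulVM (sieveOut E g) N) (σ := 1 + α) (by linarith)
    (summable_norm_mulVM_div_rpow (norm_sieveOut_le hgb E) (by linarith))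
  simp only [ofReal_one_add] at h
  exact h

/-- … and for the block pieces. [folklore] -/
theorem integrable_normSq_vmIn_div (hgb : ∀ n, ‖g n‖ ≤ 1) (P : Finset ℕ) {α : ℝ} (hα : 0 < α) :
    Integrable fun y : ℝ => ‖LSeries (vmIn P g N) (1 + α + y * I)‖ ^ 2 / ‖(1 : ℂ) + α + y * I‖ ^ 2 := by
  have h := integrable_norm_LSeries_sq_div (a := vmIn P g N) (σ := 1 + α) (by linarith)
    (summable_norm_vmIn_div_rpow hgb P (by linarith))
  simp only [ofReal_one_add] at h
  exact h

/-- **The window** (substitute for GS03 (3.12)): if `‖𝒢_a(1+α+iy)‖ ≤ B` for `|y| ≤ T₀` and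
`‖𝒢_{a_i}(1+α+iy)‖ ≤ B_c` for all `y` and `i`, then
`∫_{|y|≤T₀} |D_a/s|² ≤ 2B² ∫_ℝ |P_∁/s|² + 2B_c² |𝓙| ∑_i ∫_ℝ |P_i/s|²`. [folklore] -/
theorem setIntegral_window_restr_le [DecidableEq ι] (h : IsBlockSystem 𝓙 blk N)
    (hg : ∀ m n, g (m * n) = g m * g n) (hg1 : g 1 = 1) (hgb : ∀ n, ‖g n‖ ≤ 1) {α : ℝ} (hα : 0 < α)
    {T₀ B Bc : ℝ}
    (hB : ∀ y : ℝ, |y| ≤ T₀ → ‖LSeries (restr 𝓙 blk g N) (1 + α + y * I)‖ ≤ B)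
    (hBc : ∀ i ∈ 𝓙, ∀ y : ℝ, ‖LSeries (restr (𝓙.erase i) blk g N) (1 + α + y * I)‖ ≤ Bc) :
    ∫ y in Set.Icc (-T₀) T₀, ‖LSeries (mulLog (restr 𝓙 blk g N) N) (1 + α + y * I)‖ ^ 2 /
        ‖(1 : ℂ) + α + y * I‖ ^ 2 ≤
      2 * B ^ 2 * (∫ y : ℝ, ‖LSeries (mulVM (sieveOut (𝓙.biUnion blk) g) N) (1 + α + y * I)‖ ^ 2 /
          ‖(1 : ℂ) + α + y * I‖ ^ 2) +
        2 * Bc ^ 2 * 𝓙.card * ∑ i ∈ 𝓙, ∫ y : ℝ, ‖LSeries (vmIn (blk i) g N) (1 + α + y * I)‖ ^ 2 /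
          ‖(1 : ℂ) + α + y * I‖ ^ 2 := by
  set F₀ : ℝ → ℝ := fun y => ‖LSeries (mulVM (sieveOut (𝓙.biUnion blk) g) N) (1 + α + y * I)‖ ^ 2 /
    ‖(1 : ℂ) + α + y * I‖ ^ 2 with hF₀
  set F : ι → ℝ → ℝ := fun i y => ‖LSeries (vmIn (blk i) g N) (1 + α + y * I)‖ ^ 2 /
    ‖(1 : ℂ) + α + y * I‖ ^ 2 with hF
  have hF₀int : Integrable F₀ := integrable_normSq_mulVM_sieveOut_div (N := N) hgb _ hα
  have hFint : ∀ i ∈ 𝓙, Integrable (F i) := fun i _ => integrable_normSq_vmIn_div (N := N) hgb _ hα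
  have hDint := integrable_normSq_mulLog_div (g := restr 𝓙 blk g N) (N := N) (norm_restr_le_one hgb) hα
  set R : ℝ → ℝ := fun y => 2 * B ^ 2 * F₀ y + 2 * Bc ^ 2 * 𝓙.card * ∑ i ∈ 𝓙, F i y with hR
  have hRint : Integrable R := by
    refine Integrable.add (hF₀int.const_mul _) ?_
    exact (integrable_finsetSum 𝓙 hFint).const_mul _
  have hR0 : 0 ≤ᵐ[volume] R := Filter.Eventually.of_forall fun y => by
    simp only [hR, hF₀, hF]
    have : 0 ≤ ∑ i ∈ 𝓙, ‖LSeries (vmIn (blk i) g N) (1 + ↑α + ↑y * I)‖ ^ 2 / ‖(1 : ℂ) + ↑α + ↑y * I‖ ^ 2 :=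
      Finset.sum_nonneg fun i _ => by positivity
    positivity
  have hres : ((1 : ℂ) + α + (0 : ℝ) * I).re = 1 + α := by simp
  calc ∫ y in Set.Icc (-T₀) T₀, ‖LSeries (mulLog (restr 𝓙 blk g N) N) (1 + α + y * I)‖ ^ 2 /
          ‖(1 : ℂ) + α + y * I‖ ^ 2
      ≤ ∫ y in Set.Icc (-T₀) T₀, R y := by
        refine setIntegral_mono_on hDint.integrableOn hRint.integrableOn measurableSet_Icc fun y hy => ?_
        have hyT : |y| ≤ T₀ := abs_le.2 ⟨by linarith [hy.1], hy.2⟩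
        have hsre : 1 < ((1 : ℂ) + α + y * I).re := by simp; linarith
        have hpt := norm_mulLog_restr_sq_le h hg hg1 hgb hsre (hB y hyT) (fun i hi => hBc i hi y)
        have hw : 0 < ‖(1 : ℂ) + α + y * I‖ ^ 2 := by
          have : ((1 : ℂ) + α + y * I) ≠ 0 := by
            intro h0; have := congrArg Complex.re h0; simp at this; linarith
          positivity
        simp only [hR, hF₀, hF]
        calc ‖LSeries (mulLog (restr 𝓙 blk g N) N) (1 + α + y * I)‖ ^ 2 / ‖(1 : ℂ) + α + y * I‖ ^ 2
            ≤ (2 * B ^ 2 * ‖LSeries (mulVM (sieveOut (𝓙.biUnion blk) g) N) (1 + α + y * I)‖ ^ 2 +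
                2 * Bc ^ 2 * 𝓙.card * ∑ i ∈ 𝓙, ‖LSeries (vmIn (blk i) g N) (1 + α + y * I)‖ ^ 2) /
                ‖(1 : ℂ) + α + y * I‖ ^ 2 := div_le_div_of_nonneg_right hpt hw.le
          _ = _ := by rw [add_div, mul_div_assoc, mul_div_assoc, Finset.sum_div]
    _ ≤ ∫ y, R y := setIntegral_le_integral hRint hR0
    _ = 2 * B ^ 2 * (∫ y, F₀ y) + 2 * Bc ^ 2 * 𝓙.card * ∑ i ∈ 𝓙, ∫ y, F i y := by
        simp only [hR]
        rw [integral_add (hF₀int.const_mul _) ((integrable_finsetSum 𝓙 hFint).const_mul _),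
          integral_const_mul, integral_const_mul, integral_finsetSum 𝓙 hFint]
        try rfl

/-! ### The outside piece: `∫ |P_∁/s|² ≤ 2π · 18/α` -/

/-- **Mean square of the outside piece** (Chebyshev `ψ(y) ≤ 6y`, tree `meanSquare_mulVM_le` applied to
the sifted function `g 1_{(·,E)=1}`): `∫_ℝ |P_∁(1+α+iy)|²/|1+α+iy|² dy ≤ 2π · 18/α`. [cite: GranvilleSoundararajan2003, §3b] -/
theorem integral_normSq_mulVM_sieveOut_le (hgb : ∀ n, ‖g n‖ ≤ 1) (E : Finset ℕ) {α : ℝ} (hα : 0 < α) :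
    ∫ y : ℝ, ‖LSeries (mulVM (sieveOut E g) N) (1 + α + y * I)‖ ^ 2 / ‖(1 : ℂ) + α + y * I‖ ^ 2 ≤
      2 * π * (18 / α) := by
  have hb := norm_sieveOut_le hgb E
  have h1 := meanSquare_mulVM_eq (N := N) hb hα
  have h2 := meanSquare_mulVM_le (N := N) hb hα
  rw [h1] at h2
  have hπ : 0 < 2 * π := by positivity
  have hX : ∀ X : ℝ, X = 2 * π * (1 / (2 * π) * X) := fun X => by field_simp
  calc ∫ y : ℝ, ‖LSeries (mulVM (sieveOut E g) N) (1 + α + y * I)‖ ^ 2 / ‖(1 : ℂ) + α + y * I‖ ^ 2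
      = 2 * π * (1 / (2 * π) * ∫ y : ℝ, ‖LSeries (mulVM (sieveOut E g) N) (1 + α + y * I)‖ ^ 2 /
          ‖(1 : ℂ) + α + y * I‖ ^ 2) := hX _
    _ ≤ 2 * π * (18 / α) := by gcongr

/-! ### The block pieces: counting prime powers -/

/-- For a prime `p` and `Y ≥ 1`: `∑_{n ≤ Y, p ∣ n} Λ(n) ≤ log Y` (the `n` that count are the powers
`p^k ≤ Y`, `k ≥ 1`, each with `Λ = log p`, and there are `≤ log Y/log p` of them). [folklore] -/
theorem sum_vonMangoldt_filter_dvd_le {p : ℕ} (hp : p.Prime) {Y : ℕ} (hY : 1 ≤ Y) :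
    ∑ n ∈ (Finset.Icc 1 Y).filter (p ∣ ·), (vonMangoldt n : ℝ) ≤ Real.log Y := by
  classical
  set S := ((Finset.Icc 1 Y).filter (p ∣ ·)).filter (fun n => IsPrimePow n) with hS
  -- terms outside `S` vanish
  have hsplit : ∑ n ∈ (Finset.Icc 1 Y).filter (p ∣ ·), (vonMangoldt n : ℝ) = ∑ n ∈ S, (vonMangoldt n : ℝ) := by
    rw [hS]
    exact (Finset.sum_filter_of_ne fun n _ hne => ArithmeticFunction.vonMangoldt_ne_zero_iff.mp hne).symm
  -- on `S` every term equals `log p`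
  have hterm : ∀ n ∈ S, (vonMangoldt n : ℝ) = Real.log p := by
    intro n hn
    simp only [hS, Finset.mem_filter] at hn
    obtain ⟨⟨-, hpn⟩, hpp⟩ := hn
    obtain ⟨q, k, hq, hk, rfl⟩ := (isPrimePow_nat_iff _).mp hpp
    have hqp : p = q := (prime_dvd_primePow_iff hq hp hk).mp hpn
    subst hqp
    rw [ArithmeticFunction.vonMangoldt_apply_pow hk.ne', ArithmeticFunction.vonMangoldt_apply_prime hp]
  -- `S ⊆ {p^k : 1 ≤ k ≤ log_p Y}`
  have hsub : S ⊆ (Finset.Icc 1 (Nat.log p Y)).image (fun k => p ^ k) := by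
    intro n hn
    simp only [hS, Finset.mem_filter, Finset.mem_Icc] at hn
    obtain ⟨⟨⟨-, hnY⟩, hpn⟩, hpp⟩ := hn
    obtain ⟨q, k, hq, hk, rfl⟩ := (isPrimePow_nat_iff _).mp hpp
    have hqp : p = q := (prime_dvd_primePow_iff hq hp hk).mp hpn
    subst hqp
    rw [Finset.mem_image]
    exact ⟨k, Finset.mem_Icc.mpr ⟨hk, Nat.le_log_of_pow_le hp.one_lt hnY⟩, rfl⟩
  have hcard : (S.card : ℝ) ≤ Nat.log p Y := by
    have h1 := Finset.card_le_card hsub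
    have h2 : ((Finset.Icc 1 (Nat.log p Y)).image (fun k => p ^ k)).card ≤ Nat.log p Y :=
      Finset.card_image_le.trans (by simp)
    exact_mod_cast h1.trans h2
  have hlogp : 0 < Real.log p := Real.log_pos (by exact_mod_cast hp.one_lt)
  have hpow : (Nat.log p Y : ℝ) * Real.log p ≤ Real.log Y := by
    have h1 : p ^ Nat.log p Y ≤ Y := Nat.pow_log_le_self p (by omega)
    have h2 : Real.log ((p : ℝ) ^ Nat.log p Y) ≤ Real.log Y :=
      Real.log_le_log (pow_pos (by exact_mod_cast hp.pos) _) (by exact_mod_cast h1)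
    rwa [Real.log_pow] at h2
  rw [hsplit, Finset.sum_congr rfl hterm, Finset.sum_const, nsmul_eq_mul]
  calc (S.card : ℝ) * Real.log p ≤ Nat.log p Y * Real.log p := by gcongr
    _ ≤ Real.log Y := hpow

/-- **Partial sums of a block piece**: for a set `P` of primes and `y ≥ 1`,
`‖∑_{n ≤ y} (g̃Λ1_P)(n)‖ ≤ |P| log y`. [folklore] -/
theorem norm_psum_vmIn_le_card_mul_log (hgb : ∀ n, ‖g n‖ ≤ 1) {P : Finset ℕ} (hP : ∀ p ∈ P, p.Prime)
    {y : ℝ} (hy : 1 ≤ y) : ‖psum (vmIn P g N) y‖ ≤ P.card * Real.log y := by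
  classical
  have hY : 1 ≤ ⌊y⌋₊ := Nat.le_floor (by simpa using hy)
  have hy0 : 0 < y := by linarith
  -- termwise: `‖vmIn(n)‖ ≤ ∑_{p ∈ P} Λ(n) [p ∣ n]`
  have hterm : ∀ n : ℕ, ‖vmIn P g N n‖ ≤ ∑ p ∈ P, if p ∣ n then (vonMangoldt n : ℝ) else 0 := by
    intro n
    by_cases hcop : ∀ p ∈ P, ¬ p ∣ n
    · rw [vmIn_eq_zero_of_forall P hcop, norm_zero]
      exact Finset.sum_nonneg fun p _ => by split_ifs <;> simp [ArithmeticFunction.vonMangoldt_nonneg]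
    · push Not at hcop
      obtain ⟨p₀, hp₀, hdvd⟩ := hcop
      calc ‖vmIn P g N n‖ ≤ vonMangoldt n := norm_vmIn_le hgb P n
        _ = if p₀ ∣ n then (vonMangoldt n : ℝ) else 0 := by rw [if_pos hdvd]
        _ ≤ ∑ p ∈ P, if p ∣ n then (vonMangoldt n : ℝ) else 0 :=
            Finset.single_le_sum (f := fun p => if p ∣ n then (vonMangoldt n : ℝ) else 0)
              (fun p _ => by split_ifs <;> simp [ArithmeticFunction.vonMangoldt_nonneg]) hp₀
  calc ‖psum (vmIn P g N) y‖ ≤ ∑ n ∈ Finset.Icc 1 ⌊y⌋₊, ‖vmIn P g N n‖ := MellinPlancherel.norm_psum_le _ _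
    _ ≤ ∑ n ∈ Finset.Icc 1 ⌊y⌋₊, ∑ p ∈ P, if p ∣ n then (vonMangoldt n : ℝ) else 0 :=
        Finset.sum_le_sum fun n _ => hterm n
    _ = ∑ p ∈ P, ∑ n ∈ (Finset.Icc 1 ⌊y⌋₊).filter (p ∣ ·), (vonMangoldt n : ℝ) := by
        rw [Finset.sum_comm]
        refine Finset.sum_congr rfl fun p _ => ?_
        rw [Finset.sum_filter]
    _ ≤ ∑ p ∈ P, Real.log ⌊y⌋₊ := Finset.sum_le_sum fun p hp => sum_vonMangoldt_filter_dvd_le (hP p hp) hY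
    _ = P.card * Real.log ⌊y⌋₊ := by rw [Finset.sum_const, nsmul_eq_mul]
    _ ≤ P.card * Real.log y := by
        have hfl : Real.log ⌊y⌋₊ ≤ Real.log y :=
          Real.log_le_log (Nat.cast_pos.mpr (by omega)) (Nat.floor_le hy0.le)
        exact mul_le_mul_of_nonneg_left hfl (Nat.cast_nonneg _)

/-- `‖∑_{n ≤ y} (g̃Λ1_P)(n)‖ ≤ ψ(y)`. [folklore] -/
theorem norm_psum_vmIn_le_psi (hgb : ∀ n, ‖g n‖ ≤ 1) (P : Finset ℕ) (y : ℝ) :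
    ‖psum (vmIn P g N) y‖ ≤ Chebyshev.psi y := by
  calc ‖psum (vmIn P g N) y‖ ≤ ∑ n ∈ Finset.Icc 1 ⌊y⌋₊, ‖vmIn P g N n‖ := MellinPlancherel.norm_psum_le _ _
    _ ≤ ∑ n ∈ Finset.Icc 1 ⌊y⌋₊, (vonMangoldt n : ℝ) := Finset.sum_le_sum fun n _ => norm_vmIn_le hgb P n
    _ ≤ ∑ n ∈ Finset.Icc 0 ⌊y⌋₊, (vonMangoldt n : ℝ) :=
        Finset.sum_le_sum_of_subset_of_nonneg (Finset.Icc_subset_Icc (Nat.zero_le 1) le_rfl)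
          (fun _ _ _ => ArithmeticFunction.vonMangoldt_nonneg)
    _ = Chebyshev.psi y := (Chebyshev.psi_eq_sum_Icc y).symm

/-- `‖∑_{n ≤ y} (g̃Λ1_P)(n)‖ ≤ 6y` for `y ≥ 1` (Chebyshev: `ψ(y) ≤ (log 4 + 4) y`). [folklore] -/
theorem norm_psum_vmIn_le_six (hgb : ∀ n, ‖g n‖ ≤ 1) (P : Finset ℕ) {y : ℝ} (hy : 1 ≤ y) :
    ‖psum (vmIn P g N) y‖ ≤ 6 * y ^ (1 : ℝ) := by
  rw [Real.rpow_one]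
  refine (norm_psum_vmIn_le_psi hgb P y).trans ((Chebyshev.psi_le_const_mul_self (by linarith)).trans ?_)
  have h4 : Real.log 4 ≤ 2 := by
    have h2 : Real.log 4 = 2 * Real.log 2 := by
      rw [show (4:ℝ) = 2 ^ 2 by norm_num, Real.log_pow]; ring
    rw [h2]; linarith [Real.log_two_lt_d9]
  nlinarith

/-! ### The block pieces: the mean square `∫ |∑_{n ≤ e^u} (g̃Λ1_P)(n)|² e^{-2(1+α)u} du ≤ 36 log Q + 25` -/

/-- **Chebyshev for the size of a block**: a set `P` of primes `≤ Q` (`Q ≥ e²`) has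
`|P| ≤ 5Q/log Q` (Mathlib's `Chebyshev.pi_le_log4_mul_div`: `π(Q) ≤ log 4 · Q/log √Q + √Q`, and
`√Q ≤ 2Q/log Q`). [folklore] -/
theorem card_le_of_primes_le {P : Finset ℕ} {Q : ℝ} (hQ : Real.exp 2 ≤ Q)
    (hP : ∀ p ∈ P, p.Prime ∧ (p : ℝ) ≤ Q) : (P.card : ℝ) ≤ 5 * Q / Real.log Q := by
  have hQ1 : 1 < Q := lt_of_lt_of_le (by linarith [Real.add_one_le_exp (2:ℝ)]) hQ
  have hQ0 : 0 < Q := by linarith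
  have hL : 2 ≤ Real.log Q := by
    rw [← Real.log_exp 2]; exact Real.log_le_log (Real.exp_pos 2) hQ
  have hL0 : 0 < Real.log Q := by linarith
  -- `P ⊆ primesLE ⌊Q⌋`
  have hsub : P ⊆ Nat.primesLE ⌊Q⌋₊ := by
    intro p hp
    rw [Nat.mem_primesLE]
    exact ⟨Nat.le_floor (hP p hp).2, (hP p hp).1⟩
  have hcard : (P.card : ℝ) ≤ Nat.primeCounting ⌊Q⌋₊ := by
    rw [← Nat.primesLE_card_eq_primeCounting]
    exact_mod_cast Finset.card_le_card hsub
  have hπ := Chebyshev.pi_le_log4_mul_div hQ1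
  rw [Real.log_sqrt hQ0.le] at hπ
  -- `√Q ≤ 2Q/log Q`
  have hsqrt : Real.sqrt Q ≤ 2 * Q / Real.log Q := by
    have hs0 : 0 < Real.sqrt Q := Real.sqrt_pos.mpr hQ0
    have h1 : Real.log (Real.sqrt Q) ≤ Real.sqrt Q - 1 := Real.log_le_sub_one_of_pos hs0
    rw [Real.log_sqrt hQ0.le] at h1
    have hlogle : Real.log Q ≤ 2 * Real.sqrt Q := by linarith
    rw [le_div_iff₀ hL0]
    have hsq : Real.sqrt Q * Real.sqrt Q = Q := Real.mul_self_sqrt hQ0.le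
    nlinarith
  have hl4 : Real.log 4 ≤ 1.4 := by
    have h2 : Real.log 4 = 2 * Real.log 2 := by
      rw [show (4:ℝ) = 2 ^ 2 by norm_num, Real.log_pow]; ring
    rw [h2]; linarith [Real.log_two_lt_d9]
  have hmain : Real.log 4 * Q / (Real.log Q / 2) ≤ 3 * Q / Real.log Q := by
    rw [div_div_eq_mul_div, div_le_div_iff₀ hL0 hL0]
    have hQL : 0 < Q * Real.log Q := mul_pos hQ0 hL0
    nlinarith [mul_le_mul_of_nonneg_right hl4 hQL.le]
  calc (P.card : ℝ) ≤ Nat.primeCounting ⌊Q⌋₊ := hcard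
    _ ≤ Real.log 4 * Q / (Real.log Q / 2) + Real.sqrt Q := hπ
    _ ≤ 3 * Q / Real.log Q + 2 * Q / Real.log Q := add_le_add hmain hsqrt
    _ = 5 * Q / Real.log Q := by ring

/-- `u² ≤ L² e^{u-L}` for `u ≥ L ≥ 2` (since `u/L = 1 + (u-L)/L ≤ 1 + (u-L)/2 ≤ e^{(u-L)/2}`). [folklore] -/
theorem sq_le_sq_mul_exp {L u : ℝ} (hL : 2 ≤ L) (hu : L ≤ u) : u ^ 2 ≤ L ^ 2 * Real.exp (u - L) := by
  set t := u - L with ht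
  have ht0 : 0 ≤ t := by rw [ht]; linarith
  have hu' : u = L * (1 + t / L) := by field_simp; ring
  have h1 : 1 + t / L ≤ 1 + t / 2 := by
    gcongr
  have h2 : 1 + t / 2 ≤ Real.exp (t / 2) := by linarith [Real.add_one_le_exp (t / 2)]
  have h3 : 0 ≤ 1 + t / L := by positivity
  have h4 : (1 + t / L) ^ 2 ≤ Real.exp (t / 2) ^ 2 := pow_le_pow_left₀ h3 (h1.trans h2) 2
  have h5 : Real.exp (t / 2) ^ 2 = Real.exp t := by rw [← Real.exp_nat_mul]; ring_nf
  calc u ^ 2 = L ^ 2 * (1 + t / L) ^ 2 := by rw [hu']; ring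
    _ ≤ L ^ 2 * Real.exp (t / 2) ^ 2 := by gcongr
    _ = L ^ 2 * Real.exp t := by rw [h5]

/-- **Mean square of a block piece**: for a set `P` of primes `≤ Q` (so `|P| ≤ 5Q/log Q`), `Q ≥ e²`,
`0 < α`: `∫_ℝ |∑_{n ≤ e^u} (g̃Λ1_P)(n)|² e^{-2(1+α)u} du ≤ 36 log Q + 25` — the partial sums are
`≤ min(6 e^u, |P| u)`, and `∫_0^{log Q} 36 du + ∫_{log Q}^∞ |P|² u² e^{-2u} du ≤ 36 log Q + 25`. [folklore] -/
theorem meanSquare_vmIn_le (hgb : ∀ n, ‖g n‖ ≤ 1) {P : Finset ℕ} (hPp : ∀ p ∈ P, p.Prime) {Q : ℝ}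
    (hQ : Real.exp 2 ≤ Q) (hcard : (P.card : ℝ) ≤ 5 * Q / Real.log Q) {α : ℝ} (hα : 0 < α) :
    ∫ u : ℝ, ‖psum (vmIn P g N) (Real.exp u)‖ ^ 2 * Real.exp (-(2 * (1 + α) * u)) ≤
      36 * Real.log Q + 25 := by
  set L : ℝ := Real.log Q with hLdef
  have hQ0 : 0 < Q := lt_of_lt_of_le (Real.exp_pos 2) hQ
  have hL : 2 ≤ L := by
    rw [hLdef, ← Real.log_exp 2]; exact Real.log_le_log (Real.exp_pos 2) hQ
  have hL0 : 0 < L := by linarith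
  have hexpL : Real.exp L = Q := by rw [hLdef, Real.exp_log hQ0]
  set c : ℝ := (P.card : ℝ) with hc
  have hc0 : 0 ≤ c := Nat.cast_nonneg _
  set K : ℝ := c ^ 2 * L ^ 2 * Real.exp (-L) with hK
  have hK0 : 0 ≤ K := by positivity
  -- the majorant
  set F : ℝ → ℝ := fun u => (Set.Icc 0 L).indicator (fun _ => (36 : ℝ)) u +
    (Set.Ioi L).indicator (fun u => K * Real.exp (-u)) u with hF
  have hF1int : Integrable ((Set.Icc 0 L).indicator (fun _ : ℝ => (36 : ℝ))) := by
    rw [integrable_indicator_iff measurableSet_Icc]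
    exact integrableOn_const (by rw [Real.volume_Icc]; exact ENNReal.ofReal_ne_top)
  have hF2int : Integrable ((Set.Ioi L).indicator (fun u : ℝ => K * Real.exp (-u))) := by
    rw [integrable_indicator_iff measurableSet_Ioi]
    exact (integrableOn_exp_neg_Ioi L).const_mul K
  have hFint : Integrable F := hF1int.add hF2int
  have hFval : ∫ u, F u = 36 * L + K * Real.exp (-L) := by
    simp only [hF]
    rw [integral_add hF1int hF2int, integral_indicator_const _ measurableSet_Icc, measureReal_def,
      Real.volume_Icc, ENNReal.toReal_ofReal (by linarith), integral_indicator measurableSet_Ioi,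
      integral_const_mul, integral_exp_neg_Ioi, smul_eq_mul]
    ring
  -- pointwise comparison
  have hle : ∀ u : ℝ, ‖psum (vmIn P g N) (Real.exp u)‖ ^ 2 * Real.exp (-(2 * (1 + α) * u)) ≤ F u := by
    intro u
    rcases lt_or_ge u 0 with hu | hu
    · -- `u < 0`: the partial sum is empty
      rw [MellinPlancherel.psum_of_lt_one _ (by simpa using Real.exp_lt_one_iff.mpr hu)]
      simp only [norm_zero]
      rw [zero_pow two_ne_zero, zero_mul]
      simp only [hF]
      refine add_nonneg (Set.indicator_nonneg (fun _ _ => by norm_num) _)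
        (Set.indicator_nonneg (fun v _ => by positivity) _)
    · have h1 : (1 : ℝ) ≤ Real.exp u := by simpa using Real.one_le_exp hu
      rcases le_or_gt u L with huL | huL
      · -- `0 ≤ u ≤ L`: Chebyshev
        have hb := norm_psum_vmIn_le_six (N := N) hgb P h1
        rw [Real.rpow_one] at hb
        have hval : F u = 36 := by
          simp only [hF]
          rw [Set.indicator_of_mem (Set.mem_Icc.mpr ⟨hu, huL⟩),
            Set.indicator_of_notMem (by simpa using huL), add_zero]
        rw [hval]
        have hexp : (6 * Real.exp u) ^ 2 * Real.exp (-(2 * (1 + α) * u)) = 36 * Real.exp (-(2 * α) * u) := by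
          rw [mul_pow, sq (Real.exp u), ← Real.exp_add, mul_assoc, ← Real.exp_add]
          congr 1
          · norm_num
          · congr 1; ring
        have hexp1 : Real.exp (-(2 * α) * u) ≤ 1 := by
          rw [Real.exp_le_one_iff]; nlinarith
        calc ‖psum (vmIn P g N) (Real.exp u)‖ ^ 2 * Real.exp (-(2 * (1 + α) * u))
            ≤ (6 * Real.exp u) ^ 2 * Real.exp (-(2 * (1 + α) * u)) := by gcongr
          _ = 36 * Real.exp (-(2 * α) * u) := hexp
          _ ≤ 36 * 1 := by gcongr
          _ = 36 := mul_one _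
      · -- `u > L`: the block is short
        have hb := norm_psum_vmIn_le_card_mul_log (N := N) hgb hPp h1
        rw [Real.log_exp] at hb
        have hval : F u = K * Real.exp (-u) := by
          simp only [hF]
          rw [Set.indicator_of_notMem (by simp [huL]), Set.indicator_of_mem (Set.mem_Ioi.mpr huL), zero_add]
        rw [hval]
        have hu2 := sq_le_sq_mul_exp hL huL.le
        have hexp2 : Real.exp (-(2 * (1 + α) * u)) ≤ Real.exp (-(2 * u)) := by
          rw [Real.exp_le_exp]; nlinarith
        calc ‖psum (vmIn P g N) (Real.exp u)‖ ^ 2 * Real.exp (-(2 * (1 + α) * u))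
            ≤ (c * u) ^ 2 * Real.exp (-(2 * u)) := by gcongr
          _ = c ^ 2 * u ^ 2 * Real.exp (-(2 * u)) := by ring
          _ ≤ c ^ 2 * (L ^ 2 * Real.exp (u - L)) * Real.exp (-(2 * u)) := by gcongr
          _ = K * Real.exp (-u) := by
              simp only [hK]
              have : Real.exp (u - L) * Real.exp (-(2 * u)) = Real.exp (-L) * Real.exp (-u) := by
                rw [← Real.exp_add, ← Real.exp_add]; congr 1; ring
              calc c ^ 2 * (L ^ 2 * Real.exp (u - L)) * Real.exp (-(2 * u))
                  = c ^ 2 * L ^ 2 * (Real.exp (u - L) * Real.exp (-(2 * u))) := by ring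
                _ = c ^ 2 * L ^ 2 * (Real.exp (-L) * Real.exp (-u)) := by rw [this]
                _ = c ^ 2 * L ^ 2 * Real.exp (-L) * Real.exp (-u) := by ring
  -- `K e^{-L} = c² L² e^{-2L} ≤ 25`
  have hKL : K * Real.exp (-L) ≤ 25 := by
    have hcL : c * L ≤ 5 * Q := by
      have := hcard
      rw [le_div_iff₀ hL0] at this
      simpa [hc] using this
    have hcL0 : 0 ≤ c * L := by positivity
    have h2 : (c * L) ^ 2 ≤ (5 * Q) ^ 2 := pow_le_pow_left₀ hcL0 hcL 2
    have hee : Real.exp (-L) * Real.exp (-L) * Q ^ 2 = 1 := by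
      rw [← hexpL, ← Real.exp_add, sq, ← Real.exp_add, ← Real.exp_add]
      convert Real.exp_zero using 2
      ring
    calc K * Real.exp (-L) = (c * L) ^ 2 * (Real.exp (-L) * Real.exp (-L)) := by simp only [hK]; ring
      _ ≤ (5 * Q) ^ 2 * (Real.exp (-L) * Real.exp (-L)) := by gcongr
      _ = 25 * (Real.exp (-L) * Real.exp (-L) * Q ^ 2) := by ring
      _ = 25 := by rw [hee, mul_one]
  have hnonneg : 0 ≤ᵐ[volume] fun u : ℝ => ‖psum (vmIn P g N) (Real.exp u)‖ ^ 2 * Real.exp (-(2 * (1 + α) * u)) :=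
    Filter.Eventually.of_forall fun u => by positivity
  calc ∫ u : ℝ, ‖psum (vmIn P g N) (Real.exp u)‖ ^ 2 * Real.exp (-(2 * (1 + α) * u))
      ≤ ∫ u, F u := integral_mono_of_nonneg hnonneg hFint (Filter.Eventually.of_forall hle)
    _ = 36 * L + K * Real.exp (-L) := hFval
    _ ≤ 36 * L + 25 := by linarith

/-- **The weighted integral of a block piece**: `∫_ℝ |P_i(1+α+iy)|²/|1+α+iy|² dy ≤ 2π (36 log Q + 25)`.
[folklore] -/
theorem integral_normSq_vmIn_le (hgb : ∀ n, ‖g n‖ ≤ 1) {P : Finset ℕ} (hPp : ∀ p ∈ P, p.Prime) {Q : ℝ}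
    (hQ : Real.exp 2 ≤ Q) (hcard : (P.card : ℝ) ≤ 5 * Q / Real.log Q) {α : ℝ} (hα : 0 < α) :
    ∫ y : ℝ, ‖LSeries (vmIn P g N) (1 + α + y * I)‖ ^ 2 / ‖(1 : ℂ) + α + y * I‖ ^ 2 ≤
      2 * π * (36 * Real.log Q + 25) := by
  have h1 := MellinPlancherel.integral_norm_sq_psum_exp (a := vmIn P g N) (σ := 1 + α)
    (θ := 1) (C := 6) (by linarith) (summable_norm_vmIn_div_rpow hgb P (by linarith))
    (by linarith) (fun y hy => norm_psum_vmIn_le_six hgb P hy)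
  simp only [ofReal_one_add] at h1
  have h2 := meanSquare_vmIn_le (N := N) hgb hPp hQ hcard hα
  rw [h1] at h2
  have hπ : 0 < 2 * π := by positivity
  have hX : ∀ X : ℝ, X = 2 * π * (1 / (2 * π) * X) := fun X => by field_simp
  calc ∫ y : ℝ, ‖LSeries (vmIn P g N) (1 + α + y * I)‖ ^ 2 / ‖(1 : ℂ) + α + y * I‖ ^ 2
      = 2 * π * (1 / (2 * π) * ∫ y : ℝ, ‖LSeries (vmIn P g N) (1 + α + y * I)‖ ^ 2 /
          ‖(1 : ℂ) + α + y * I‖ ^ 2) := hX _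
    _ ≤ 2 * π * (36 * Real.log Q + 25) := by gcongr

/-! ### The coefficients `c_n = (a log)(n)/n^{1+α}`: an `α`-free `ℓ²` bound -/

/-- `(log n / n)² ≤ 16/(n √n)` for `n ≥ 1` (`log n ≤ 4 n^{1/4}`). [folklore] -/
theorem log_div_sq_le {n : ℕ} (hn : 1 ≤ n) : (Real.log n / n) ^ 2 ≤ 16 / ((n : ℝ) * Real.sqrt n) := by
  have hn0 : (0 : ℝ) < n := by exact_mod_cast hn
  have hsq0 : 0 < Real.sqrt n := Real.sqrt_pos.mpr hn0
  have h1 : Real.log n ≤ 4 * (n : ℝ) ^ (1 / 4 : ℝ) := by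
    have := Real.log_le_rpow_div hn0.le (by norm_num : (0:ℝ) < 1 / 4)
    linarith
  have h0 : 0 ≤ Real.log n := Real.log_nonneg (by exact_mod_cast hn)
  have h2 : Real.log n ^ 2 ≤ 16 * Real.sqrt n := by
    have h3 : ((n : ℝ) ^ (1 / 4 : ℝ)) ^ 2 = Real.sqrt n := by
      rw [← Real.rpow_natCast, ← Real.rpow_mul hn0.le, Real.sqrt_eq_rpow]; norm_num
    calc Real.log n ^ 2 ≤ (4 * (n : ℝ) ^ (1 / 4 : ℝ)) ^ 2 := pow_le_pow_left₀ h0 h1 2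
      _ = 16 * Real.sqrt n := by rw [mul_pow, h3]; norm_num
  have hss : Real.sqrt n * Real.sqrt n = n := Real.mul_self_sqrt hn0.le
  rw [div_pow, div_le_div_iff₀ (by positivity) (by positivity)]
  have h3 := mul_le_mul_of_nonneg_right h2 (by positivity : 0 ≤ (n : ℝ) * Real.sqrt n)
  have h4 : 16 * Real.sqrt n * ((n : ℝ) * Real.sqrt n) = 16 * (n : ℝ) ^ 2 := by
    calc 16 * Real.sqrt n * ((n : ℝ) * Real.sqrt n) = 16 * n * (Real.sqrt n * Real.sqrt n) := by ring
      _ = 16 * (n : ℝ) ^ 2 := by rw [hss]; ring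
  linarith

/-- The telescoping step `1/((m+1)√(m+1)) ≤ 2/√m - 2/√(m+1)` (`m ≥ 1`). [folklore] -/
theorem inv_mul_sqrt_le_sub {m : ℝ} (hm : 1 ≤ m) :
    1 / ((m + 1) * Real.sqrt (m + 1)) ≤ 2 / Real.sqrt m - 2 / Real.sqrt (m + 1) := by
  set a := Real.sqrt m with ha
  set b := Real.sqrt (m + 1) with hb
  have ha0 : 0 < a := Real.sqrt_pos.mpr (by linarith)
  have hb0 : 0 < b := Real.sqrt_pos.mpr (by linarith)
  have ha2 : a * a = m := Real.mul_self_sqrt (by linarith)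
  have hb2 : b * b = m + 1 := Real.mul_self_sqrt (by linarith)
  have hab : a ≤ b := Real.sqrt_le_sqrt (by linarith)
  rw [← hb2, div_sub_div _ _ ha0.ne' hb0.ne', div_le_div_iff₀ (by positivity) (by positivity)]
  -- `a b ≤ (2b - 2a) b² (b b)`? rearranged: with `b² - a² = 1`, `(b - a)(a + b) = 1`
  have hdiff : (b - a) * (b + a) = 1 := by nlinarith
  nlinarith [mul_pos ha0 hb0, hab, hdiff, sq_nonneg (b - a)]

/-- `∑_{1 ≤ n ≤ M} 1/(n √n) ≤ 3 - 2/√M` (`M ≥ 1`). [folklore] -/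
theorem sum_inv_mul_sqrt_le {M : ℕ} (hM : 1 ≤ M) :
    ∑ n ∈ Finset.Icc 1 M, 1 / ((n : ℝ) * Real.sqrt n) ≤ 3 - 2 / Real.sqrt M := by
  induction M, hM using Nat.le_induction with
  | base => simp; norm_num
  | succ m hm ih =>
      rw [Finset.sum_Icc_succ_top (by omega), Nat.cast_succ]
      have hm1 : (1 : ℝ) ≤ m := by exact_mod_cast hm
      have := inv_mul_sqrt_le_sub hm1
      linarith

/-- **The `ℓ²` bound**: for `1`-bounded `g` and `α ≥ 0`, the coefficients `c_n = (g̃ log)(n)/n^{1+α}`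
satisfy `∑ |c_n|² ≤ 48` (uniformly in `α`). [folklore] -/
theorem tsum_norm_term_mulLog_sq_le (hgb : ∀ n, ‖g n‖ ≤ 1) {α : ℝ} (hα : 0 ≤ α) :
    Summable (fun n : ℕ => ‖LSeries.term (mulLog g N) (1 + α) n‖ ^ 2) ∧
      ∑' n : ℕ, ‖LSeries.term (mulLog g N) (1 + α) n‖ ^ 2 ≤ 48 := by
  -- termwise bound by `16/(n √n)` (and `0` at `n = 0`)
  set b : ℕ → ℝ := fun n => if n = 0 then 0 else 16 / ((n : ℝ) * Real.sqrt n) with hb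
  have hle : ∀ n : ℕ, ‖LSeries.term (mulLog g N) (1 + α) n‖ ^ 2 ≤ b n := by
    intro n
    rcases Nat.eq_zero_or_pos n with rfl | hn
    · simp [hb]
    · have hn0 : (0 : ℝ) < n := by exact_mod_cast hn
      simp only [hb, if_neg hn.ne']
      have h1 : ‖LSeries.term (mulLog g N) (1 + α) n‖ ≤ Real.log n / n := by
        rw [show ((1 : ℂ) + α) = (((1 + α : ℝ)) : ℂ) by push_cast; ring, LSeries.term_of_ne_zero hn.ne',
          norm_div, show (n : ℂ) = ((n : ℝ) : ℂ) by simp, ← Complex.ofReal_cpow (Nat.cast_nonneg n),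
          Complex.norm_real, Real.norm_of_nonneg (by positivity)]
        have hpow : (n : ℝ) ≤ (n : ℝ) ^ (1 + α) := by
          calc (n : ℝ) = (n : ℝ) ^ (1 : ℝ) := (Real.rpow_one _).symm
            _ ≤ (n : ℝ) ^ (1 + α) := Real.rpow_le_rpow_of_exponent_le (by exact_mod_cast hn) (by linarith)
        calc ‖mulLog g N n‖ / (n : ℝ) ^ (1 + α) ≤ Real.log n / (n : ℝ) ^ (1 + α) := by
              gcongr; exact norm_mulLog_le hgb n
          _ ≤ Real.log n / n := div_le_div_of_nonneg_left (Real.log_nonneg (by exact_mod_cast hn)) hn0 hpow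
      calc ‖LSeries.term (mulLog g N) (1 + α) n‖ ^ 2 ≤ (Real.log n / n) ^ 2 :=
            pow_le_pow_left₀ (norm_nonneg _) h1 2
        _ ≤ 16 / ((n : ℝ) * Real.sqrt n) := log_div_sq_le hn
  -- partial sums of `b`
  have hpart : ∀ M : ℕ, ∑ n ∈ Finset.range M, b n ≤ 48 := by
    intro M
    rcases Nat.eq_zero_or_pos M with rfl | hM
    · simp
    · have hsplit : ∑ n ∈ Finset.range M, b n = ∑ n ∈ Finset.Icc 1 (M - 1), b n := by
        have : Finset.range M = insert 0 (Finset.Icc 1 (M - 1)) := by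
          ext n; simp only [Finset.mem_range, Finset.mem_insert, Finset.mem_Icc]; omega
        rw [this, Finset.sum_insert (by simp)]
        simp [hb]
      rw [hsplit]
      rcases Nat.eq_zero_or_pos (M - 1) with h0 | h1
      · rw [h0]; simp
      · have heq : ∑ n ∈ Finset.Icc 1 (M - 1), b n = 16 * ∑ n ∈ Finset.Icc 1 (M - 1), 1 / ((n : ℝ) * Real.sqrt n) := by
          rw [Finset.mul_sum]
          refine Finset.sum_congr rfl fun n hn => ?_
          rw [Finset.mem_Icc] at hn
          simp only [hb, if_neg (show n ≠ 0 by omega)]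
          ring
        rw [heq]
        have h2 := sum_inv_mul_sqrt_le h1
        have h3 : 0 ≤ 2 / Real.sqrt ((M - 1 : ℕ) : ℝ) := by positivity
        linarith
  have hb0 : ∀ n, 0 ≤ b n := fun n => by
    simp only [hb]; split_ifs <;> positivity
  have hbsum : Summable b := summable_of_sum_range_le hb0 hpart
  have hsum : Summable (fun n : ℕ => ‖LSeries.term (mulLog g N) (1 + α) n‖ ^ 2) :=
    Summable.of_nonneg_of_le (fun n => by positivity) hle hbsum
  refine ⟨hsum, ?_⟩
  calc ∑' n : ℕ, ‖LSeries.term (mulLog g N) (1 + α) n‖ ^ 2 ≤ ∑' n, b n := hsum.tsum_le_tsum hle hbsum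
    _ ≤ 48 := Real.tsum_le_of_sum_range_le hb0 hpart

/-! ### The tails `|y| > T₀` by dyadic blocks -/

/-- **One dyadic block** `[a, 2a]` (`a > 0`): by the mean value theorem sharp in the length
(`DirichletMVTSharp.meanSquare_tsum_shift_le`, half-length `a/2`), Rankin's bound
`∑ n |c_n|² ≤ 4e^{10}/α³` and `∑ |c_n|² ≤ 48`:
`∫_a^{2a} |D(1+α+it)|² dt ≤ 120 a + 960 + 260 e^{10}/α³`. [cite: MontgomeryVaughan1974, Corollary 3] -/
theorem integral_dyadic_block_le (hgb : ∀ n, ‖g n‖ ≤ 1) {α : ℝ} (hα : 0 < α) (hα1 : α ≤ 1) {a : ℝ}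
    (ha : 0 < a) :
    ∫ t in a..(2 * a), ‖LSeries (mulLog g N) (1 + α + t * I)‖ ^ 2 ≤
      120 * a + 960 + 260 * Real.exp 10 / α ^ 3 := by
  set c : ℕ → ℂ := fun n => LSeries.term (mulLog g N) (1 + α) n with hc_def
  have hc : Summable fun n => ‖c n‖ :=
    (LSeriesSummable_mulLog (g := g) (N := N) hgb (s := 1 + α) (by simp; linarith)).norm
  obtain ⟨hc2, hR⟩ := Halasz.tsum_mul_norm_term_mulLog_sq_le (g := g) (N := N) hgb hα hα1
  obtain ⟨hc1, hC⟩ := tsum_norm_term_mulLog_sq_le (g := g) (N := N) hgb hα.le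
  have h0 : c 0 = 0 := LSeries.term_zero _ _
  have hmvt := DirichletMVT.meanSquare_tsum_shift_le hc hc2 h0 (W := a / 2) (by positivity) (3 * a / 2)
  have hlo : 3 * a / 2 - a / 2 = a := by ring
  have hhi : 3 * a / 2 + a / 2 = 2 * a := by ring
  rw [hlo, hhi] at hmvt
  have hint : ∫ t in a..(2 * a), ‖LSeries (mulLog g N) (1 + α + t * I)‖ ^ 2 =
      ∫ t in a..(2 * a), ‖∑' n : ℕ, c n * (n : ℂ) ^ (-((t : ℂ) * I))‖ ^ 2 := by
    refine intervalIntegral.integral_congr fun t _ => ?_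
    simp only [hc_def, LSeries_mulLog_line_eq_tsum]
  rw [hint]
  refine hmvt.trans ?_
  have hsplit : ∀ n : ℕ, (5 * (a / 2) + 20 + 65 * (n : ℝ)) * ‖c n‖ ^ 2 =
      (5 * (a / 2) + 20) * ‖c n‖ ^ 2 + 65 * ((n : ℝ) * ‖c n‖ ^ 2) := fun n => by ring
  have hs1 : Summable fun n : ℕ => (5 * (a / 2) + 20) * ‖c n‖ ^ 2 := hc1.mul_left _
  have hs2 : Summable fun n : ℕ => 65 * ((n : ℝ) * ‖c n‖ ^ 2) := hc2.mul_left _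
  calc ∑' n : ℕ, (5 * (a / 2) + 20 + 65 * (n : ℝ)) * ‖c n‖ ^ 2
      = ∑' n : ℕ, ((5 * (a / 2) + 20) * ‖c n‖ ^ 2 + 65 * ((n : ℝ) * ‖c n‖ ^ 2)) := tsum_congr hsplit
    _ = (5 * (a / 2) + 20) * ∑' n : ℕ, ‖c n‖ ^ 2 + 65 * ∑' n : ℕ, ((n : ℝ) * ‖c n‖ ^ 2) := by
        rw [hs1.tsum_add hs2, tsum_mul_left, tsum_mul_left]
    _ ≤ (5 * (a / 2) + 20) * 48 + 65 * (4 * Real.exp 10 / α ^ 3) := by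
        gcongr
    _ = 120 * a + 960 + 260 * Real.exp 10 / α ^ 3 := by ring

/-- A dyadic block `[a, 2a)` to the right of the window, with the weight: for `a ≥ 1`,
`∫_{[a,2a)} |D|²/|s|² ≤ 120/a + (960 + 260e^{10}/α³)/a²`. [folklore] -/
theorem setIntegral_Ico_dyadic_le (hgb : ∀ n, ‖g n‖ ≤ 1) {α : ℝ} (hα : 0 < α) (hα1 : α ≤ 1)
    {a : ℝ} (ha : 1 ≤ a) :
    ∫ y in Set.Ico a (2 * a), ‖LSeries (mulLog g N) (1 + α + y * I)‖ ^ 2 / ‖(1 : ℂ) + α + y * I‖ ^ 2 ≤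
      120 / a + (960 + 260 * Real.exp 10 / α ^ 3) / a ^ 2 := by
  have ha0 : 0 < a := by linarith
  have hint := integrable_normSq_mulLog_div (N := N) hgb hα
  have hcont := continuous_norm_LSeries_mulLog_sq (N := N) hgb hα
  have hpos : 0 < 1 + a ^ 2 := by positivity
  calc ∫ y in Set.Ico a (2 * a), ‖LSeries (mulLog g N) (1 + α + y * I)‖ ^ 2 / ‖(1 : ℂ) + α + y * I‖ ^ 2
      ≤ ∫ y in Set.Ico a (2 * a), ‖LSeries (mulLog g N) (1 + α + y * I)‖ ^ 2 / (1 + a ^ 2) := by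
        refine setIntegral_mono_on hint.integrableOn ?_ measurableSet_Ico fun y hy => ?_
        · exact (hcont.div_const _).integrableOn_Icc.mono_set Set.Ico_subset_Icc_self
        · exact normSq_div_le_of_le_abs hα.le ha0.le (by rw [abs_of_nonneg (ha0.le.trans hy.1)]; exact hy.1)
    _ = (∫ y in a..(2 * a), ‖LSeries (mulLog g N) (1 + α + y * I)‖ ^ 2) / (1 + a ^ 2) := by
        rw [intervalIntegral.integral_of_le (by linarith), integral_Ico_eq_integral_Ioc, integral_div]
    _ ≤ (120 * a + 960 + 260 * Real.exp 10 / α ^ 3) / (1 + a ^ 2) := by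
        gcongr; exact integral_dyadic_block_le hgb hα hα1 ha0
    _ ≤ (120 * a + 960 + 260 * Real.exp 10 / α ^ 3) / a ^ 2 :=
        div_le_div_of_nonneg_left (by positivity) (by positivity) (by linarith)
    _ = 120 / a + (960 + 260 * Real.exp 10 / α ^ 3) / a ^ 2 := by
        field_simp
        ring

/-- The mirror block `(-2a, -a]`: `∫ ≤ 120/a + (960 + 260e^{10}/α³)/a²`. [folklore] -/
theorem setIntegral_Ioc_neg_dyadic_le (hgb : ∀ n, ‖g n‖ ≤ 1) {α : ℝ} (hα : 0 < α) (hα1 : α ≤ 1)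
    {a : ℝ} (ha : 1 ≤ a) :
    ∫ y in Set.Ioc (-(2 * a)) (-a), ‖LSeries (mulLog g N) (1 + α + y * I)‖ ^ 2 / ‖(1 : ℂ) + α + y * I‖ ^ 2 ≤
      120 / a + (960 + 260 * Real.exp 10 / α ^ 3) / a ^ 2 := by
  have ha0 : 0 < a := by linarith
  have hint := integrable_normSq_mulLog_div (N := N) hgb hα
  have hcont := continuous_norm_LSeries_mulLog_sq (N := N) hgb hα
  have hpos : 0 < 1 + a ^ 2 := by positivity
  calc ∫ y in Set.Ioc (-(2 * a)) (-a), ‖LSeries (mulLog g N) (1 + α + y * I)‖ ^ 2 / ‖(1 : ℂ) + α + y * I‖ ^ 2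
      ≤ ∫ y in Set.Ioc (-(2 * a)) (-a), ‖LSeries (mulLog g N) (1 + α + y * I)‖ ^ 2 / (1 + a ^ 2) := by
        refine setIntegral_mono_on hint.integrableOn ?_ measurableSet_Ioc fun y hy => ?_
        · exact (hcont.div_const _).integrableOn_Icc.mono_set Set.Ioc_subset_Icc_self
        · refine normSq_div_le_of_le_abs hα.le ha0.le ?_
          rw [abs_of_nonpos (by linarith [hy.2])]
          linarith [hy.2]
    _ = (∫ y in (-(2 * a))..(-a), ‖LSeries (mulLog g N) (1 + α + y * I)‖ ^ 2) / (1 + a ^ 2) := by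
        rw [intervalIntegral.integral_of_le (by linarith), integral_div]
    _ ≤ (120 * a + 960 + 260 * Real.exp 10 / α ^ 3) / (1 + a ^ 2) := by
        gcongr
        -- shift: the mean value bound is translation invariant; redo it on `[-2a, -a]`
        set c : ℕ → ℂ := fun n => LSeries.term (mulLog g N) (1 + α) n with hc_def
        have hc : Summable fun n => ‖c n‖ :=
          (LSeriesSummable_mulLog (g := g) (N := N) hgb (s := 1 + α) (by simp; linarith)).norm
        obtain ⟨hc2, hR⟩ := Halasz.tsum_mul_norm_term_mulLog_sq_le (g := g) (N := N) hgb hα hα1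
        obtain ⟨hc1, hC⟩ := tsum_norm_term_mulLog_sq_le (g := g) (N := N) hgb hα.le
        have h0 : c 0 = 0 := LSeries.term_zero _ _
        have hmvt := DirichletMVT.meanSquare_tsum_shift_le hc hc2 h0 (W := a / 2) (by positivity) (-(3 * a / 2))
        have hlo : -(3 * a / 2) - a / 2 = -(2 * a) := by ring
        have hhi : -(3 * a / 2) + a / 2 = -a := by ring
        rw [hlo, hhi] at hmvt
        have hint' : ∫ t in (-(2 * a))..(-a), ‖LSeries (mulLog g N) (1 + α + t * I)‖ ^ 2 =
            ∫ t in (-(2 * a))..(-a), ‖∑' n : ℕ, c n * (n : ℂ) ^ (-((t : ℂ) * I))‖ ^ 2 := by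
          refine intervalIntegral.integral_congr fun t _ => ?_
          simp only [hc_def, LSeries_mulLog_line_eq_tsum]
        rw [hint']
        refine hmvt.trans ?_
        have hsplit : ∀ n : ℕ, (5 * (a / 2) + 20 + 65 * (n : ℝ)) * ‖c n‖ ^ 2 =
            (5 * (a / 2) + 20) * ‖c n‖ ^ 2 + 65 * ((n : ℝ) * ‖c n‖ ^ 2) := fun n => by ring
        have hs1 : Summable fun n : ℕ => (5 * (a / 2) + 20) * ‖c n‖ ^ 2 := hc1.mul_left _
        have hs2 : Summable fun n : ℕ => 65 * ((n : ℝ) * ‖c n‖ ^ 2) := hc2.mul_left _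
        calc ∑' n : ℕ, (5 * (a / 2) + 20 + 65 * (n : ℝ)) * ‖c n‖ ^ 2
            = ∑' n : ℕ, ((5 * (a / 2) + 20) * ‖c n‖ ^ 2 + 65 * ((n : ℝ) * ‖c n‖ ^ 2)) := tsum_congr hsplit
          _ = (5 * (a / 2) + 20) * ∑' n : ℕ, ‖c n‖ ^ 2 + 65 * ∑' n : ℕ, ((n : ℝ) * ‖c n‖ ^ 2) := by
              rw [hs1.tsum_add hs2, tsum_mul_left, tsum_mul_left]
          _ ≤ (5 * (a / 2) + 20) * 48 + 65 * (4 * Real.exp 10 / α ^ 3) := by gcongr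
          _ = 120 * a + 960 + 260 * Real.exp 10 / α ^ 3 := by ring
    _ ≤ (120 * a + 960 + 260 * Real.exp 10 / α ^ 3) / a ^ 2 :=
        div_le_div_of_nonneg_left (by positivity) (by positivity) (by linarith)
    _ = 120 / a + (960 + 260 * Real.exp 10 / α ^ 3) / a ^ 2 := by
        field_simp
        ring

/-- Block bookkeeping: `120/(T₀2^k) + K/(T₀2^k)² ≤ (120/T₀ + K/T₀²)(1/2)^k` (`T₀ > 0`, `K ≥ 0`). [folklore] -/
theorem dyadic_weight_le {T₀ K : ℝ} (hT₀ : 0 < T₀) (hK : 0 ≤ K) (k : ℕ) :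
    120 / (T₀ * 2 ^ k) + K / (T₀ * 2 ^ k) ^ 2 ≤ (120 / T₀ + K / T₀ ^ 2) * (1 / 2) ^ k := by
  have h2k : (1 : ℝ) ≤ 2 ^ k := one_le_pow₀ (by norm_num)
  have h2k0 : (0 : ℝ) < 2 ^ k := by positivity
  have hhalf : (1 / 2 : ℝ) ^ k = 1 / 2 ^ k := by rw [div_pow, one_pow]
  rw [hhalf]
  have h1 : 120 / (T₀ * 2 ^ k) = 120 / T₀ * (1 / 2 ^ k) := by field_simp
  have h2 : K / (T₀ * 2 ^ k) ^ 2 ≤ K / T₀ ^ 2 * (1 / 2 ^ k) := by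
    have hsq : (2 : ℝ) ^ k ≤ (2 ^ k) ^ 2 := by nlinarith
    have heq : K / T₀ ^ 2 * (1 / 2 ^ k) = K / (T₀ ^ 2 * 2 ^ k) := by field_simp
    rw [heq, mul_pow]
    exact div_le_div_of_nonneg_left hK (by positivity) (by gcongr)
  rw [h1, add_mul]
  linarith

/-- **The right tail by dyadic blocks**: for `T₀ ≥ 1`, `0 < α ≤ 1`,
`∫_{y ≥ T₀} |D|²/|s|² ≤ 240/T₀ + (1920 + 520 e^{10}/α³)/T₀²`. [cite: GranvilleSoundararajan2003, Lemma 3.2] -/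
theorem setIntegral_Ici_dyadic_tail_le (hgb : ∀ n, ‖g n‖ ≤ 1) {α : ℝ} (hα : 0 < α) (hα1 : α ≤ 1)
    {T₀ : ℝ} (hT₀ : 1 ≤ T₀) :
    ∫ y in Set.Ici T₀, ‖LSeries (mulLog g N) (1 + α + y * I)‖ ^ 2 / ‖(1 : ℂ) + α + y * I‖ ^ 2 ≤
      240 / T₀ + (1920 + 520 * Real.exp 10 / α ^ 3) / T₀ ^ 2 := by
  have hT0 : 0 < T₀ := by linarith
  set K : ℝ := 960 + 260 * Real.exp 10 / α ^ 3 with hK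
  have hK0 : 0 ≤ K := by positivity
  set S : ℕ → Set ℝ := fun k => Set.Ico (T₀ * 2 ^ k) (T₀ * 2 ^ (k + 1)) with hS
  have hSm : ∀ k, MeasurableSet (S k) := fun k => measurableSet_Ico
  have hSd : Pairwise (Function.onFun Disjoint S) := by
    intro k l hkl
    rcases lt_or_gt_of_ne hkl with h | h
    · refine Set.disjoint_left.2 fun y hy hy' => ?_
      simp only [hS, Set.mem_Ico] at hy hy'
      have : (2 : ℝ) ^ (k + 1) ≤ 2 ^ l := pow_le_pow_right₀ (by norm_num) h
      nlinarith
    · refine Set.disjoint_left.2 fun y hy hy' => ?_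
      simp only [hS, Set.mem_Ico] at hy hy'
      have : (2 : ℝ) ^ (l + 1) ≤ 2 ^ k := pow_le_pow_right₀ (by norm_num) h
      nlinarith
  have hSU : (⋃ k, S k) = Set.Ici T₀ := by
    ext y
    simp only [Set.mem_iUnion, hS, Set.mem_Ico, Set.mem_Ici]
    constructor
    · rintro ⟨k, hk, -⟩
      have : (1 : ℝ) ≤ 2 ^ k := one_le_pow₀ (by norm_num)
      nlinarith
    · intro hy
      obtain ⟨n, hn1, hn2⟩ := exists_nat_pow_near (x := y / T₀) (y := (2 : ℝ))
        (by rw [le_div_iff₀ hT0]; linarith) (by norm_num)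
      refine ⟨n, ?_, ?_⟩
      · rw [le_div_iff₀ hT0] at hn1; linarith
      · rw [div_lt_iff₀ hT0] at hn2; linarith
  have hint := integrable_normSq_mulLog_div (N := N) hgb hα
  have hsum := hasSum_integral_iUnion (μ := volume) (f := (fun y : ℝ => ‖LSeries (mulLog g N) (1 + α + y * I)‖ ^ 2
          / ‖(1 : ℂ) + α + y * I‖ ^ 2)) hSm hSd hint.integrableOn
  rw [hSU] at hsum
  have hb : ∀ k : ℕ, ∫ y in S k, ‖LSeries (mulLog g N) (1 + α + y * I)‖ ^ 2
          / ‖(1 : ℂ) + α + y * I‖ ^ 2 ≤ (120 / T₀ + K / T₀ ^ 2) * (1 / 2) ^ k := by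
    intro k
    have hak : 1 ≤ T₀ * 2 ^ k := by
      have : (1 : ℝ) ≤ 2 ^ k := one_le_pow₀ (by norm_num)
      nlinarith
    have h1 := setIntegral_Ico_dyadic_le (N := N) hgb hα hα1 hak
    have h2 : Set.Ico (T₀ * 2 ^ k) (2 * (T₀ * 2 ^ k)) = S k := by
      simp only [hS]; congr 1; ring
    rw [h2] at h1
    exact h1.trans (dyadic_weight_le hT0 hK0 k)
  have hgeom : ∀ n : ℕ, ∑ k ∈ Finset.range n, (120 / T₀ + K / T₀ ^ 2) * (1 / 2 : ℝ) ^ k ≤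
      (120 / T₀ + K / T₀ ^ 2) * 2 := by
    intro n
    rw [← Finset.mul_sum]
    exact mul_le_mul_of_nonneg_left (sum_geometric_two_le n) (by positivity)
  have hbsum : Summable fun k : ℕ => (120 / T₀ + K / T₀ ^ 2) * (1 / 2 : ℝ) ^ k :=
    summable_of_sum_range_le (fun k => by positivity) hgeom
  have htsum : ∑' k : ℕ, (120 / T₀ + K / T₀ ^ 2) * (1 / 2 : ℝ) ^ k ≤ (120 / T₀ + K / T₀ ^ 2) * 2 :=
    Real.tsum_le_of_sum_range_le (fun k => by positivity) hgeom
  calc ∫ y in Set.Ici T₀, ‖LSeries (mulLog g N) (1 + α + y * I)‖ ^ 2 / ‖(1 : ℂ) + α + y * I‖ ^ 2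
      = ∑' k : ℕ, ∫ y in S k, ‖LSeries (mulLog g N) (1 + α + y * I)‖ ^ 2
              / ‖(1 : ℂ) + α + y * I‖ ^ 2 := hsum.tsum_eq.symm
    _ ≤ ∑' k : ℕ, (120 / T₀ + K / T₀ ^ 2) * (1 / 2 : ℝ) ^ k := hsum.summable.tsum_le_tsum hb hbsum
    _ ≤ (120 / T₀ + K / T₀ ^ 2) * 2 := htsum
    _ = 240 / T₀ + (1920 + 520 * Real.exp 10 / α ^ 3) / T₀ ^ 2 := by
        simp only [hK]; field_simp; ring

/-- **The right tail** `∫_{y > T₀} |D|²/|s|² ≤ 240/T₀ + (1920 + 520 e^{10}/α³)/T₀²` (`T₀ ≥ 1`). [folklore] -/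
theorem setIntegral_Ioi_dyadic_tail_le (hgb : ∀ n, ‖g n‖ ≤ 1) {α : ℝ} (hα : 0 < α) (hα1 : α ≤ 1)
    {T₀ : ℝ} (hT₀ : 1 ≤ T₀) :
    ∫ y in Set.Ioi T₀, ‖LSeries (mulLog g N) (1 + α + y * I)‖ ^ 2 / ‖(1 : ℂ) + α + y * I‖ ^ 2 ≤
      240 / T₀ + (1920 + 520 * Real.exp 10 / α ^ 3) / T₀ ^ 2 := by
  have hint := integrable_normSq_mulLog_div (N := N) hgb hα
  refine le_trans ?_ (setIntegral_Ici_dyadic_tail_le (N := N) hgb hα hα1 hT₀)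
  exact setIntegral_mono_set hint.integrableOn (Filter.Eventually.of_forall fun y => by positivity)
    Set.Ioi_subset_Ici_self.eventuallyLE

/-- **The left tail by dyadic blocks**: `∫_{y ≤ -T₀} |D|²/|s|² ≤ 240/T₀ + (1920 + 520 e^{10}/α³)/T₀²`. [folklore] -/
theorem setIntegral_Iic_dyadic_tail_le (hgb : ∀ n, ‖g n‖ ≤ 1) {α : ℝ} (hα : 0 < α) (hα1 : α ≤ 1)
    {T₀ : ℝ} (hT₀ : 1 ≤ T₀) :
    ∫ y in Set.Iic (-T₀), ‖LSeries (mulLog g N) (1 + α + y * I)‖ ^ 2 / ‖(1 : ℂ) + α + y * I‖ ^ 2 ≤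
      240 / T₀ + (1920 + 520 * Real.exp 10 / α ^ 3) / T₀ ^ 2 := by
  have hT0 : 0 < T₀ := by linarith
  set K : ℝ := 960 + 260 * Real.exp 10 / α ^ 3 with hK
  have hK0 : 0 ≤ K := by positivity
  set S : ℕ → Set ℝ := fun k => Set.Ioc (-(T₀ * 2 ^ (k + 1))) (-(T₀ * 2 ^ k)) with hS
  have hSm : ∀ k, MeasurableSet (S k) := fun k => measurableSet_Ioc
  have hSd : Pairwise (Function.onFun Disjoint S) := by
    intro k l hkl
    rcases lt_or_gt_of_ne hkl with h | h
    · refine Set.disjoint_left.2 fun y hy hy' => ?_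
      simp only [hS, Set.mem_Ioc] at hy hy'
      have : (2 : ℝ) ^ (k + 1) ≤ 2 ^ l := pow_le_pow_right₀ (by norm_num) h
      nlinarith
    · refine Set.disjoint_left.2 fun y hy hy' => ?_
      simp only [hS, Set.mem_Ioc] at hy hy'
      have : (2 : ℝ) ^ (l + 1) ≤ 2 ^ k := pow_le_pow_right₀ (by norm_num) h
      nlinarith
  have hSU : (⋃ k, S k) = Set.Iic (-T₀) := by
    ext y
    simp only [Set.mem_iUnion, hS, Set.mem_Ioc, Set.mem_Iic]
    constructor
    · rintro ⟨k, -, hk⟩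
      have : (1 : ℝ) ≤ 2 ^ k := one_le_pow₀ (by norm_num)
      nlinarith
    · intro hy
      obtain ⟨n, hn1, hn2⟩ := exists_nat_pow_near (x := -y / T₀) (y := (2 : ℝ))
        (by rw [le_div_iff₀ hT0]; linarith) (by norm_num)
      refine ⟨n, ?_, ?_⟩
      · rw [div_lt_iff₀ hT0] at hn2; linarith
      · rw [le_div_iff₀ hT0] at hn1; linarith
  have hint := integrable_normSq_mulLog_div (N := N) hgb hα
  have hsum := hasSum_integral_iUnion (μ := volume) (f := (fun y : ℝ => ‖LSeries (mulLog g N) (1 + α + y * I)‖ ^ 2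
          / ‖(1 : ℂ) + α + y * I‖ ^ 2)) hSm hSd hint.integrableOn
  rw [hSU] at hsum
  have hb : ∀ k : ℕ, ∫ y in S k, ‖LSeries (mulLog g N) (1 + α + y * I)‖ ^ 2
          / ‖(1 : ℂ) + α + y * I‖ ^ 2 ≤ (120 / T₀ + K / T₀ ^ 2) * (1 / 2) ^ k := by
    intro k
    have hak : 1 ≤ T₀ * 2 ^ k := by
      have : (1 : ℝ) ≤ 2 ^ k := one_le_pow₀ (by norm_num)
      nlinarith
    have h1 := setIntegral_Ioc_neg_dyadic_le (N := N) hgb hα hα1 hak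
    have h2 : Set.Ioc (-(2 * (T₀ * 2 ^ k))) (-(T₀ * 2 ^ k)) = S k := by
      simp only [hS]; congr 2; ring
    rw [h2] at h1
    exact h1.trans (dyadic_weight_le hT0 hK0 k)
  have hgeom : ∀ n : ℕ, ∑ k ∈ Finset.range n, (120 / T₀ + K / T₀ ^ 2) * (1 / 2 : ℝ) ^ k ≤
      (120 / T₀ + K / T₀ ^ 2) * 2 := by
    intro n
    rw [← Finset.mul_sum]
    exact mul_le_mul_of_nonneg_left (sum_geometric_two_le n) (by positivity)
  have hbsum : Summable fun k : ℕ => (120 / T₀ + K / T₀ ^ 2) * (1 / 2 : ℝ) ^ k :=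
    summable_of_sum_range_le (fun k => by positivity) hgeom
  have htsum : ∑' k : ℕ, (120 / T₀ + K / T₀ ^ 2) * (1 / 2 : ℝ) ^ k ≤ (120 / T₀ + K / T₀ ^ 2) * 2 :=
    Real.tsum_le_of_sum_range_le (fun k => by positivity) hgeom
  calc ∫ y in Set.Iic (-T₀), ‖LSeries (mulLog g N) (1 + α + y * I)‖ ^ 2 / ‖(1 : ℂ) + α + y * I‖ ^ 2
      = ∑' k : ℕ, ∫ y in S k, ‖LSeries (mulLog g N) (1 + α + y * I)‖ ^ 2
              / ‖(1 : ℂ) + α + y * I‖ ^ 2 := hsum.tsum_eq.symm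
    _ ≤ ∑' k : ℕ, (120 / T₀ + K / T₀ ^ 2) * (1 / 2 : ℝ) ^ k := hsum.summable.tsum_le_tsum hb hbsum
    _ ≤ (120 / T₀ + K / T₀ ^ 2) * 2 := htsum
    _ = 240 / T₀ + (1920 + 520 * Real.exp 10 / α ^ 3) / T₀ ^ 2 := by
        simp only [hK]; field_simp; ring

/-- **The left tail** `∫_{y < -T₀} |D|²/|s|² ≤ 240/T₀ + (1920 + 520 e^{10}/α³)/T₀²` (`T₀ ≥ 1`). [folklore] -/
theorem setIntegral_Iio_dyadic_tail_le (hgb : ∀ n, ‖g n‖ ≤ 1) {α : ℝ} (hα : 0 < α) (hα1 : α ≤ 1)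
    {T₀ : ℝ} (hT₀ : 1 ≤ T₀) :
    ∫ y in Set.Iio (-T₀), ‖LSeries (mulLog g N) (1 + α + y * I)‖ ^ 2 / ‖(1 : ℂ) + α + y * I‖ ^ 2 ≤
      240 / T₀ + (1920 + 520 * Real.exp 10 / α ^ 3) / T₀ ^ 2 := by
  have hint := integrable_normSq_mulLog_div (N := N) hgb hα
  refine le_trans ?_ (setIntegral_Iic_dyadic_tail_le (N := N) hgb hα hα1 hT₀)
  exact setIntegral_mono_set hint.integrableOn (Filter.Eventually.of_forall fun y => by positivity)
    Set.Iio_subset_Iic_self.eventuallyLE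

/-! ### The mean square bound (substitute for GS03 Lemma 3.2) -/

/-- **Granville–Soundararajan's Lemma 3.2 for the restricted function** (explicit, crude constants).
Let `a = g̃ 1_𝒮` for a block system of primes `≤ Q` (`Q ≥ e²`), `0 < α ≤ 1`, `T₀ ≥ 1`; suppose
`‖𝒢_a(1+α+iy)‖ ≤ B` for `|y| ≤ T₀` and `‖𝒢_{a_i}(1+α+iy)‖ ≤ B_c` for all `y`, `i`.  Then
`∫_ℝ |A(e^u)|² e^{-2(1+α)u} du ≤ 36B²/α + 2B_c²|𝓙|²(36 log Q + 25) + (1/π)(240/T₀ + (1920 + 520e^{10}/α³)/T₀²)`,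
`A(y) = ∑_{n ≤ y} a(n) log n`. [cite: GranvilleSoundararajan2003, Lemma 3.2] -/
theorem meanSquare_mulLog_restr_le [DecidableEq ι] (h : IsBlockSystem 𝓙 blk N)
    (hg : ∀ m n, g (m * n) = g m * g n) (hg1 : g 1 = 1) (hgb : ∀ n, ‖g n‖ ≤ 1)
    {α : ℝ} (hα : 0 < α) (hα1 : α ≤ 1) {T₀ : ℝ} (hT₀ : 1 ≤ T₀) {Q : ℝ} (hQ : Real.exp 2 ≤ Q)
    (hblkQ : ∀ i ∈ 𝓙, ∀ p ∈ blk i, (p : ℝ) ≤ Q) {B Bc : ℝ}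
    (hB : ∀ y : ℝ, |y| ≤ T₀ → ‖LSeries (restr 𝓙 blk g N) (1 + α + y * I)‖ ≤ B)
    (hBc : ∀ i ∈ 𝓙, ∀ y : ℝ, ‖LSeries (restr (𝓙.erase i) blk g N) (1 + α + y * I)‖ ≤ Bc) :
    ∫ u : ℝ, ‖psum (mulLog (restr 𝓙 blk g N) N) (Real.exp u)‖ ^ 2 * Real.exp (-(2 * (1 + α) * u)) ≤
      36 * B ^ 2 / α + 2 * Bc ^ 2 * (𝓙.card : ℝ) ^ 2 * (36 * Real.log Q + 25) +
        1 / π * (240 / T₀ + (1920 + 520 * Real.exp 10 / α ^ 3) / T₀ ^ 2) := by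
  have hab := norm_restr_le_one (𝓙 := 𝓙) (blk := blk) (N := N) hgb
  set a := restr 𝓙 blk g N with ha_def
  set Tl : ℝ := 240 / T₀ + (1920 + 520 * Real.exp 10 / α ^ 3) / T₀ ^ 2 with hTl
  have hTl0 : 0 ≤ Tl := by positivity
  -- the `P`-integrals
  set IP : ℝ := ∫ y : ℝ, ‖LSeries (mulVM (sieveOut (𝓙.biUnion blk) g) N) (1 + α + y * I)‖ ^ 2 /
    ‖(1 : ℂ) + α + y * I‖ ^ 2 with hIP
  have hIP_le : IP ≤ 2 * π * (18 / α) := integral_normSq_mulVM_sieveOut_le (N := N) hgb _ hα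
  have hIPi : ∀ i ∈ 𝓙, ∫ y : ℝ, ‖LSeries (vmIn (blk i) g N) (1 + α + y * I)‖ ^ 2 /
      ‖(1 : ℂ) + α + y * I‖ ^ 2 ≤ 2 * π * (36 * Real.log Q + 25) := by
    intro i hi
    have hPp : ∀ p ∈ blk i, p.Prime := fun p hp => h.prime_of_mem hi hp
    refine integral_normSq_vmIn_le (N := N) hgb hPp hQ ?_ hα
    exact card_le_of_primes_le hQ fun p hp => ⟨hPp p hp, hblkQ i hi p hp⟩
  have hsumIPi : ∑ i ∈ 𝓙, ∫ y : ℝ, ‖LSeries (vmIn (blk i) g N) (1 + α + y * I)‖ ^ 2 /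
      ‖(1 : ℂ) + α + y * I‖ ^ 2 ≤ 𝓙.card * (2 * π * (36 * Real.log Q + 25)) := by
    calc ∑ i ∈ 𝓙, ∫ y : ℝ, ‖LSeries (vmIn (blk i) g N) (1 + α + y * I)‖ ^ 2 / ‖(1 : ℂ) + α + y * I‖ ^ 2
        ≤ ∑ i ∈ 𝓙, 2 * π * (36 * Real.log Q + 25) := Finset.sum_le_sum hIPi
      _ = 𝓙.card * (2 * π * (36 * Real.log Q + 25)) := by rw [Finset.sum_const, nsmul_eq_mul]
  -- the `D`-integral, split
  have hD : ∫ y : ℝ, ‖LSeries (mulLog a N) (1 + α + y * I)‖ ^ 2 / ‖(1 : ℂ) + α + y * I‖ ^ 2 ≤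
      (2 * B ^ 2 * IP + 2 * Bc ^ 2 * 𝓙.card * (𝓙.card * (2 * π * (36 * Real.log Q + 25)))) + 2 * Tl := by
    refine (integral_le_window_add_tails (N := N) hab hα (by linarith : (0:ℝ) ≤ T₀)).trans ?_
    have hw := setIntegral_window_restr_le h hg hg1 hgb hα (T₀ := T₀) hB hBc
    have ht1 := setIntegral_Iio_dyadic_tail_le (N := N) hab hα hα1 hT₀
    have ht2 := setIntegral_Ioi_dyadic_tail_le (N := N) hab hα hα1 hT₀
    have hBc2 : 0 ≤ 2 * Bc ^ 2 * (𝓙.card : ℝ) := by positivity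
    have hw' : ∫ y in Set.Icc (-T₀) T₀, ‖LSeries (mulLog a N) (1 + α + y * I)‖ ^ 2 / ‖(1 : ℂ) + α + y * I‖ ^ 2 ≤
        2 * B ^ 2 * IP + 2 * Bc ^ 2 * 𝓙.card * (𝓙.card * (2 * π * (36 * Real.log Q + 25))) :=
      hw.trans (add_le_add le_rfl (mul_le_mul_of_nonneg_left hsumIPi hBc2))
    simp only [ha_def] at hw' ht1 ht2 ⊢
    linarith
  have hJ := meanSquare_mulLog_eq (N := N) hab hα
  rw [hJ]
  have hπ0 : 0 < π := Real.pi_pos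
  have h2π : 0 < 1 / (2 * π) := by positivity
  calc 1 / (2 * π) * ∫ y : ℝ, ‖LSeries (mulLog a N) (1 + α + y * I)‖ ^ 2 / ‖(1 : ℂ) + α + y * I‖ ^ 2
      ≤ 1 / (2 * π) * ((2 * B ^ 2 * IP + 2 * Bc ^ 2 * 𝓙.card * (𝓙.card * (2 * π * (36 * Real.log Q + 25)))) +
          2 * Tl) := by gcongr
    _ ≤ 1 / (2 * π) * ((2 * B ^ 2 * (2 * π * (18 / α)) +
          2 * Bc ^ 2 * 𝓙.card * (𝓙.card * (2 * π * (36 * Real.log Q + 25)))) + 2 * Tl) := by gcongr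
    _ = 36 * B ^ 2 / α + 2 * Bc ^ 2 * (𝓙.card : ℝ) ^ 2 * (36 * Real.log Q + 25) + 1 / π * Tl := by
        field_simp
        ring

end Restricted

end Halasz

end Literature.NumberTheory.LFunctions
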